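import Literature.MathematicalPhysics.QuantumManyBody.RadialVolterraEquation
import Mathlib.Analysis.SpecialFunctions.Integrals.Basic
import Mathlib.Analysis.SpecialFunctions.Trigonometric.Sinc
import Mathlib.Analysis.Complex.Trigonometric
import HarnessLib

/-!
# The Neumann scattering problem on a ball, I: the lowest Neumann eigenvalue `λ_ℓ = 3𝔞/L³ + O(L⁻⁴)`

Topic `Literature/MathematicalPhysics/QuantumManyBody`, namespace `BoseGas` (provefact
`Literature.MathematicalPhysics.QuantumManyBody.BoseGas.BastiCenatiempoSchlein2021_upperBound`, via
`…BCS2021_lhyUpperBound_dirichlet`; second file of the first-quantised input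
[BastiCenatiempoSchlein2021, Lemma 2.1] = [BoccatoEtAl2019, Lemma 4.1] = [ErdosSchleinYau2006,
Lemma A.1] of Prop. 1.3, on top of `RadialVolterraEquation.lean`).

[BastiCenatiempoSchlein2021, (2.4)]: "we fix `0 < ℓ < ½` and consider the lowest energy solution
`f_ℓ` of the Neumann problem `[-Δ + ½V] f_ℓ = λ_ℓ f_ℓ` on the ball `|x| ≤ N^{1-κ}ℓ`, with the
normalisation `f_ℓ(x) = 1` if `|x| = N^{1-κ}ℓ`"; Lemma 2.1 (i):
`|λ_ℓ - 3𝔞/(N^{1-κ}ℓ)³| ≤ (N^{1-κ}ℓ)⁻³ C𝔞²/(ℓN^{1-κ})`. Here the radius of the ball is called `L`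
(`= N^{1-κ}ℓ`), `V` is a radial profile `ℝ → [0, ∞]` of finite range `R` with `V ∈ L³(ℝ³)`
(`∫₀^∞ V³ s² < ∞`; unbounded potentials allowed), and everything is done through the radial
equation `-m'' + ½Vm = Em`, `m(0) = 0`, `f = m/r` [BoccatoEtAl2019, (B.1)], i.e. the signed
Volterra equation of `RadialVolterraEquation.lean` with coefficient `q_E = ½V - E` — no spectral
theory, Harnack inequality or maximum principle is needed for (i).

* `three_mul_mul_le`, `mul_le_cube_mul_sq_add_sqrt`, `sq_mul_le_of_scale` — AM–GM substitutes for
  Hölder: `sV ≤ (V³s² + 2√s)/3` (so `∫₀ᵀ sV < ∞`, the Volterra class) and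
  `∫₀ʳ s²V ≤ (K/3 + 2/9) r²`, `K = ∫₀^∞ V³s²` (`setIntegral_sq_mul_pot_le`, the radial form of
  `r⁻²∫_{|x|<r} V ≤ C‖V‖₃` in [BoccatoEtAl2019, App. B]);
* `neumannCoeff` (`q_E`), `integrableOn_id_mul_neumannCoeff`; energy dependence
  `abs_neumannRadial_sub_le`, `abs_neumannRadialDeriv_sub_le` (Lipschitz in `E`) and continuity;
* `neumannTail`, `volterraSol_neumannCoeff_tail`, `volterraDeriv_neumannCoeff_tail` — beyond the range
  `m_E(r) = m_E(R) cos(k(r-R)) + m_E'(R) sin(k(r-R))/k`, `k = √E` (written with `Real.sinc`, so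
  that `E = 0` is included) [BoccatoEtAl2019, (B.2); ErdosSchleinYau2006, (A.3)];
* `abs_sinc_sub_le`, `abs_cos_sub_le`, `abs_tail_combinations_le` — Taylor bounds to fourth order;
* `neumannBdry` (`g(E) = L m_E'(L) - m_E(L) = L²(m_E/r)'(L)`: the Neumann condition is
  `g(E) = 0`), `volterraScatteringLength` (`a = R - u(R)/u'(R)`, `u = m₀`; `0 ≤ a < R`;
  `g(0) = u'(R)a`), `neumannEigenvalue` (`λ_ℓ := inf{E ≥ 0 : g(E) = 0}`);
* `neumannThreshold` (`L₀(V, R)`), `neumannWindow` (`E₁ = 1/(4(L-R)²)`), `window_data`,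
  `neumannBdry_window_neg` (`g(E₁) < 0`), `exists_neumannZero` (IVT), **`neumannEigenvalue_spec`**:
  for `L ≥ L₀`, `0 ≤ λ_ℓ ≤ E₁`, `g(λ_ℓ) = 0` and `λ_ℓ` is the least such energy;
* `root_estimate`, **`abs_neumannEigenvalue_sub_le`** — **Lemma 2.1 (i)**:
  `|λ_ℓ - 3a/L³| ≤ 55R²/L⁴` and `λ_ℓ (L-R)² L ≤ 4R` for `L ≥ L₀`.

The eigenfunction `f_ℓ = m_λ/(c r)`, `0 ≤ f_ℓ ≤ 1`, `∫Vf_ℓ = 8π𝔞 + O(L⁻¹)` and the pointwise bounds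
(Lemma 2.1 (ii)–(iii)), and the identification `a = scatteringLength v` for the 3D potential, are the
sequel. No named facts; all definitions are real.

## References

* [BastiCenatiempoSchlein2021] G. Basti, S. Cenatiempo, B. Schlein, *A new second-order upper bound
  for the ground state energy of dilute Bose gases*, Forum Math. Sigma 9 (2021) e74
  (arXiv:2101.06222), (2.4)–(2.6) and Lemma 2.1 (arXiv p. 6).
* [BoccatoEtAl2019] C. Boccato, C. Brennecke, S. Cenatiempo, B. Schlein, *Optimal rate for
  Bose–Einstein condensation in the Gross–Pitaevskii regime*, Commun. Math. Phys. 376 (2020)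
  (arXiv:1812.03086), (4.1), Lemma 4.1 and App. B, (B.1)–(B.3) (arXiv pp. 12, 42).
* [ErdosSchleinYau2006] L. Erdős, B. Schlein, H.-T. Yau, *Derivation of the Gross–Pitaevskii
  hierarchy for the dynamics of Bose–Einstein condensate*, Comm. Pure Appl. Math. 59 (2006)
  (arXiv:math-ph/0410005), App. A, Lemma A.1 with (A.1)–(A.4) (arXiv pp. 35–36): the trial
  function `sin(kf(r))/r`, the root equation `kL = tan(k(L-a))`, `3a/L³(1 - C₁R/L) ≤ k² ≤ 3a/L³(1 + C₁R/L)`.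
* [LSSY2005] E. H. Lieb, R. Seiringer, J. P. Solovej, J. Yngvason, *The Mathematics of the Bose Gas
  and its Condensation* (2005), (2.4)–(2.5), App. C, Thm. C.1.
-/

noncomputable section

open MeasureTheory Set Filter Topology
open scoped ENNReal NNReal BigOperators Nat

namespace Literature.MathematicalPhysics.QuantumManyBody.BoseGas

open Real in
/-! ### Elementary inequalities replacing Hölder for radial `L³` potentials -/

section AMGM

/-- `3y ≤ y³ + 2` for `y ≥ 0` (`y³ - 3y + 2 = (y - 1)²(y + 2)`). [folklore] -/
theorem three_mul_le_cube_add_two {y : ℝ} (hy : 0 ≤ y) : 3 * y ≤ y ^ 3 + 2 := by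
  nlinarith [sq_nonneg (y - 1), mul_nonneg (sq_nonneg (y - 1)) hy]

/-- **AM–GM with a free scale**: `3ρv ≤ ρ³v³ + 2` for `ρ, v ≥ 0`; with `ρ = r` this gives
`s²v ≤ (r²v³s² + 2s²/r)/3`, the substitute for Hölder in `r⁻²∫_{|x|<r} V ≤ C‖V‖₃`.
[cite: BoccatoEtAl2019, App. B (proof of Lemma 4.1 (iii))] -/
theorem three_mul_mul_le {ρ v : ℝ} (hρ : 0 ≤ ρ) (hv : 0 ≤ v) : 3 * ρ * v ≤ ρ ^ 3 * v ^ 3 + 2 := by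
  have h := three_mul_le_cube_add_two (mul_nonneg hρ hv)
  calc 3 * ρ * v = 3 * (ρ * v) := by ring
    _ ≤ (ρ * v) ^ 3 + 2 := h
    _ = ρ ^ 3 * v ^ 3 + 2 := by ring

/-- `s v ≤ (v³ s² + 2√s)/3` for `s, v ≥ 0` (AM–GM with `y = v√s`): the weight `s V(s)` of the
Volterra theory is dominated by the radial `L³` density plus `√s`. [folklore] -/
theorem mul_le_cube_mul_sq_add_sqrt {s v : ℝ} (hs : 0 ≤ s) (hv : 0 ≤ v) :
    s * v ≤ (v ^ 3 * s ^ 2 + 2 * Real.sqrt s) / 3 := by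
  have hq := Real.sqrt_nonneg s
  have hss : Real.sqrt s * Real.sqrt s = s := Real.mul_self_sqrt hs
  have h := three_mul_le_cube_add_two (mul_nonneg hv hq)
  -- multiply `3 v√s ≤ (v√s)³ + 2` by `√s ≥ 0`
  have h2 : 3 * (v * Real.sqrt s) * Real.sqrt s ≤ ((v * Real.sqrt s) ^ 3 + 2) * Real.sqrt s :=
    mul_le_mul_of_nonneg_right h hq
  have h3 : (v * Real.sqrt s) ^ 3 * Real.sqrt s = v ^ 3 * s ^ 2 := by
    calc (v * Real.sqrt s) ^ 3 * Real.sqrt s = v ^ 3 * (Real.sqrt s * Real.sqrt s) * (Real.sqrt s * Real.sqrt s) := by ring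
      _ = v ^ 3 * s ^ 2 := by rw [hss]; ring
  nlinarith [h2, h3, hss]

/-- `s² v ≤ (r² v³ s² + 2 s²/r)/3` for `r > 0`, `v ≥ 0`. [folklore] -/
theorem sq_mul_le_of_scale {r s v : ℝ} (hr : 0 < r) (hv : 0 ≤ v) :
    s ^ 2 * v ≤ (r ^ 2 * (v ^ 3 * s ^ 2) + 2 * s ^ 2 / r) / 3 := by
  have h := three_mul_mul_le hr.le hv
  have hs2 : 0 ≤ s ^ 2 := sq_nonneg s
  have h2 : s ^ 2 * (3 * r * v) ≤ s ^ 2 * (r ^ 3 * v ^ 3 + 2) := mul_le_mul_of_nonneg_left h hs2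
  rw [le_div_iff₀ (by norm_num : (0 : ℝ) < 3)]
  have h3 : r ^ 2 * (v ^ 3 * s ^ 2) + 2 * s ^ 2 / r = s ^ 2 * (r ^ 3 * v ^ 3 + 2) / r := by
    field_simp
  rw [h3, le_div_iff₀ hr]
  calc s ^ 2 * v * 3 * r = s ^ 2 * (3 * r * v) := by ring
    _ ≤ s ^ 2 * (r ^ 3 * v ^ 3 + 2) := h2

end AMGM

/-! ### The radial coefficient `q_E = ½V - E` of a radial `L³` potential of finite range -/

section Coeff

/-- The coefficient `q_E(s) = ½V(s) - E` of the radial equation `m'' = q_E m`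
(`-m'' + ½Vm = Em`, [BoccatoEtAl2019, (B.1)]), for a `[0, ∞]`-valued potential profile `V`
(real part; the null set `{V = ∞}` is invisible to all integrals).
[cite: BoccatoEtAl2019, App. B, (B.1); BastiCenatiempoSchlein2021, (2.4)] -/
def neumannCoeff (V : ℝ → ℝ≥0∞) (E : ℝ) (s : ℝ) : ℝ := (V s).toReal / 2 - E

/-- The radial `L³` density `K = ∫₀^∞ V(s)³ s² ds` (`= ‖V‖₃³/4π`). [folklore] -/
def radialL3 (V : ℝ → ℝ≥0∞) : ℝ := ∫ s in Ioi (0 : ℝ), (V s).toReal ^ 3 * s ^ 2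

variable {V : ℝ → ℝ≥0∞} {R : ℝ}

/-- `q_E - q_{E'} = E' - E`. [folklore] -/
theorem neumannCoeff_sub (V : ℝ → ℝ≥0∞) (E E' s : ℝ) : neumannCoeff V E s - neumannCoeff V E' s = E' - E := by
  simp only [neumannCoeff]; ring

/-- `q₀ = ½V ≥ 0`. [folklore] -/
theorem neumannCoeff_zero_nonneg (V : ℝ → ℝ≥0∞) (s : ℝ) : 0 ≤ neumannCoeff V 0 s := by
  simp only [neumannCoeff, sub_zero]; positivity

/-- Beyond the range, `q_E = -E`. [folklore] -/
theorem neumannCoeff_of_range (hVR : ∀ r, R < r → V r = 0) (E : ℝ) {s : ℝ} (hs : R < s) :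
    neumannCoeff V E s = -E := by
  simp [neumannCoeff, hVR s hs]

/-- `q_E` is measurable. [folklore] -/
theorem measurable_neumannCoeff (hV : Measurable V) (E : ℝ) : Measurable (neumannCoeff V E) :=
  (hV.ennreal_toReal.div_const 2).sub measurable_const

variable (hV : Measurable V) (hV3 : ∫⁻ s in Ioi (0 : ℝ), ENNReal.ofReal (s ^ 2) * V s ^ 3 ≠ ⊤)
include hV hV3

/-- **The radial `L³` density is integrable**: `V³ s² ∈ L¹(0, ∞)`. [folklore] -/
theorem integrableOn_cube_mul_sq : IntegrableOn (fun s => (V s).toReal ^ 3 * s ^ 2) (Ioi 0) := by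
  have hmeas : Measurable fun s => (V s).toReal ^ 3 * s ^ 2 :=
    (hV.ennreal_toReal.pow_const 3).mul (measurable_id.pow_const 2)
  refine ⟨hmeas.aestronglyMeasurable, ?_⟩
  rw [hasFiniteIntegral_iff_ofReal (ae_of_all _ fun s => by positivity)]
  refine lt_of_le_of_lt (lintegral_mono fun s => ?_) (lt_top_iff_ne_top.2 hV3)
  rcases eq_or_ne (V s) ⊤ with h | h
  · simp [h]
  · rw [ENNReal.ofReal_mul (by positivity), ENNReal.ofReal_pow ENNReal.toReal_nonneg,
      ENNReal.ofReal_toReal h, mul_comm]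

omit hV hV3 in
/-- `K ≥ 0`. [folklore] -/
theorem radialL3_nonneg : 0 ≤ radialL3 V :=
  setIntegral_nonneg measurableSet_Ioi fun s _ => by positivity

/-- `∫₀ʳ V³ s² ≤ K`. [folklore] -/
theorem setIntegral_cube_mul_sq_le (r : ℝ) :
    ∫ s in Ioc 0 r, (V s).toReal ^ 3 * s ^ 2 ≤ radialL3 V :=
  setIntegral_mono_set (integrableOn_cube_mul_sq hV hV3) (ae_of_all _ fun s => by positivity)
    (ae_of_all _ Ioc_subset_Ioi_self)

/-- **The Volterra weight is finite**: `s V(s) ∈ L¹(0, T]` for a radial `L³` potential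
(`sV ≤ (V³s² + 2√s)/3`). [folklore] -/
theorem integrableOn_id_mul_pot (T : ℝ) : IntegrableOn (fun s => s * (V s).toReal) (Ioc 0 T) := by
  have hmaj : IntegrableOn (fun s => ((V s).toReal ^ 3 * s ^ 2 + 2 * Real.sqrt s) / 3) (Ioc 0 T) := by
    refine Integrable.div_const (Integrable.add ?_ ?_) _
    · exact (integrableOn_cube_mul_sq hV hV3).mono_set Ioc_subset_Ioi_self
    · exact ((Real.continuous_sqrt.const_mul 2).integrableOn_Icc (a := 0) (b := T)).mono_set
        Ioc_subset_Icc_self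
  refine Integrable.mono' hmaj ((measurable_id.mul hV.ennreal_toReal).aestronglyMeasurable) ?_
  filter_upwards [ae_restrict_mem measurableSet_Ioc] with s hs
  rw [Real.norm_eq_abs, abs_of_nonneg (mul_nonneg hs.1.le ENNReal.toReal_nonneg)]
  exact mul_le_cube_mul_sq_add_sqrt hs.1.le ENNReal.toReal_nonneg

/-- **The coefficient `q_E` is admissible**: `s q_E(s) ∈ L¹(0, T]`. [folklore] -/
theorem integrableOn_id_mul_neumannCoeff (E T : ℝ) :
    IntegrableOn (fun s => s * neumannCoeff V E s) (Ioc 0 T) := by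
  have h1 := (integrableOn_id_mul_pot hV hV3 T).div_const 2
  have h2 : IntegrableOn (fun s : ℝ => E * s) (Ioc 0 T) :=
    ((continuous_const.mul continuous_id).integrableOn_Icc (a := 0) (b := T)).mono_set Ioc_subset_Icc_self
  refine (h1.sub h2).congr (ae_of_all _ fun s => ?_)
  simp only [neumannCoeff, Pi.sub_apply]
  ring

/-- **The scale-invariant bound** `∫₀ʳ s² V(s) ds ≤ (K/3 + 2/9) r²`, `K = ∫₀^∞ V³s²` — the radial
form of `r⁻² ∫_{|x|<r} V ≤ C(‖V‖₃ + 1)`. [cite: BoccatoEtAl2019, App. B (proof of Lemma 4.1 (iii))] -/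
theorem setIntegral_sq_mul_pot_le {r : ℝ} (hr : 0 < r) :
    ∫ s in Ioc 0 r, s ^ 2 * (V s).toReal ≤ (radialL3 V / 3 + 2 / 9) * r ^ 2 := by
  have hi1 : IntegrableOn (fun s => (V s).toReal ^ 3 * s ^ 2) (Ioc 0 r) :=
    (integrableOn_cube_mul_sq hV hV3).mono_set Ioc_subset_Ioi_self
  have hi2 : IntegrableOn (fun s : ℝ => 2 * s ^ 2 / r) (Ioc 0 r) :=
    (Continuous.integrableOn_Icc (a := 0) (b := r) (by fun_prop)).mono_set Ioc_subset_Icc_self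
  have hmaj : IntegrableOn (fun s => (r ^ 2 * ((V s).toReal ^ 3 * s ^ 2) + 2 * s ^ 2 / r) / 3) (Ioc 0 r) :=
    ((hi1.const_mul _).add hi2).div_const 3
  have hle : ∀ s ∈ Ioc 0 r, s ^ 2 * (V s).toReal ≤ (r ^ 2 * ((V s).toReal ^ 3 * s ^ 2) + 2 * s ^ 2 / r) / 3 :=
    fun s _ => sq_mul_le_of_scale hr ENNReal.toReal_nonneg
  have hint : IntegrableOn (fun s => s ^ 2 * (V s).toReal) (Ioc 0 r) := by
    refine Integrable.mono' hmaj (((measurable_id.pow_const 2).mul hV.ennreal_toReal).aestronglyMeasurable) ?_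
    filter_upwards [ae_restrict_mem measurableSet_Ioc] with s hs
    rw [Real.norm_eq_abs, abs_of_nonneg (by positivity)]
    exact hle s hs
  calc ∫ s in Ioc 0 r, s ^ 2 * (V s).toReal
      ≤ ∫ s in Ioc 0 r, (r ^ 2 * ((V s).toReal ^ 3 * s ^ 2) + 2 * s ^ 2 / r) / 3 :=
        setIntegral_mono_on hint hmaj measurableSet_Ioc hle
    _ = (r ^ 2 * (∫ s in Ioc 0 r, (V s).toReal ^ 3 * s ^ 2) + 2 / r * ∫ s in Ioc 0 r, s ^ 2) / 3 := by
        rw [integral_div, integral_add (hi1.const_mul _) hi2, integral_const_mul]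
        congr 2
        rw [← integral_const_mul]
        exact setIntegral_congr_fun measurableSet_Ioc fun s _ => by ring
    _ ≤ (r ^ 2 * radialL3 V + 2 / r * (r ^ 3 / 3)) / 3 := by
        have h1 := setIntegral_cube_mul_sq_le hV hV3 r
        have h2 : ∫ s in Ioc 0 r, s ^ 2 = r ^ 3 / 3 := by
          rw [← intervalIntegral.integral_of_le hr.le, integral_pow]; ring
        rw [h2]
        gcongr
    _ = (radialL3 V / 3 + 2 / 9) * r ^ 2 := by field_simp; ring

end Coeff

/-! ### The regular radial solutions `m_E`: basic properties and energy dependence -/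

section Radial

variable {V : ℝ → ℝ≥0∞} {R : ℝ}
variable (hV : Measurable V) (hV3 : ∫⁻ s in Ioi (0 : ℝ), ENNReal.ofReal (s ^ 2) * V s ^ 3 ≠ ⊤)
include hV hV3

/-- The Volterra weight of `q_E` is at most that of `q₀ = ½V` plus `E T²/2`:
`∫₀ᵀ s|½V - E| ≤ ∫₀ᵀ s ½V + E T²/2` (`E, T ≥ 0`). [folklore] -/
theorem volterraWeight_neumannCoeff_le {E T : ℝ} (hE : 0 ≤ E) (hT : 0 ≤ T) :
    volterraWeight (neumannCoeff V E) T ≤ volterraWeight (neumannCoeff V 0) T + E * T ^ 2 / 2 := by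
  rw [volterraWeight_eq, volterraWeight_eq]
  have hI0 := integrableOn_posPart_mul_abs (integrableOn_id_mul_neumannCoeff hV hV3 0 T)
  have hIE := integrableOn_posPart_mul_abs (integrableOn_id_mul_neumannCoeff hV hV3 E T)
  rw [← setIntegral_posPart_mul_abs, ← setIntegral_posPart_mul_abs]
  have h2 : IntegrableOn (fun s : ℝ => E * s) (Ioc 0 T) :=
    ((continuous_const.mul continuous_id).integrableOn_Icc (a := 0) (b := T)).mono_set Ioc_subset_Icc_self
  have h3 : ∫ s in Ioc 0 T, E * s = E * T ^ 2 / 2 := by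
    rw [integral_const_mul, ← intervalIntegral.integral_of_le hT, integral_id]; ring
  calc ∫ s in Ioc 0 T, max s 0 * |neumannCoeff V E s|
      ≤ ∫ s in Ioc 0 T, (max s 0 * |neumannCoeff V 0 s| + E * s) := by
        refine setIntegral_mono_on hIE (hI0.add h2) measurableSet_Ioc fun s hs => ?_
        rw [max_eq_left hs.1.le]
        simp only [neumannCoeff, sub_zero]
        have h4 : |(V s).toReal / 2 - E| ≤ |(V s).toReal / 2| + E := by
          calc |(V s).toReal / 2 - E| ≤ |(V s).toReal / 2| + |E| := abs_sub _ _
            _ = _ := by rw [abs_of_nonneg hE]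
        calc s * |(V s).toReal / 2 - E| ≤ s * (|(V s).toReal / 2| + E) := mul_le_mul_of_nonneg_left h4 hs.1.le
          _ = s * |(V s).toReal / 2| + E * s := by ring
    _ = _ := by rw [integral_add hI0 h2, h3]

/-- **Energy dependence of `m_E` on `[0, T]`**: for `0 ≤ E, E'`,
`|m_E(r) - m_{E'}(r)| ≤ C_T |E - E'| r` with
`C_T = (T²/2) e^{2W + (E+E')T²/2}`, `W = ∫₀ᵀ s ½V`. [folklore] -/
theorem abs_neumannRadial_sub_le {E E' T : ℝ} (hE : 0 ≤ E) (hE' : 0 ≤ E') (hT : 0 ≤ T) {r : ℝ}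
    (hr : r ∈ Icc 0 T) :
    |volterraSol (neumannCoeff V E) r - volterraSol (neumannCoeff V E') r| ≤
      Real.exp (2 * volterraWeight (neumannCoeff V 0) T + (E + E') * T ^ 2 / 2) * (T ^ 2 / 2) * |E - E'| * r := by
  have hIE := integrableOn_id_mul_neumannCoeff hV hV3 E T
  have hIE' := integrableOn_id_mul_neumannCoeff hV hV3 E' T
  have h := abs_volterraSol_sub_volterraSol_le hIE hIE' hr
  have hδ : ∫ s in Ioc 0 T, s * |neumannCoeff V E s - neumannCoeff V E' s| = |E - E'| * (T ^ 2 / 2) := by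
    simp only [neumannCoeff_sub, abs_sub_comm E' E]
    rw [integral_mul_const, ← intervalIntegral.integral_of_le hT, integral_id]
    ring
  rw [hδ] at h
  refine h.trans ?_
  have hW := volterraWeight_neumannCoeff_le hV hV3 hE' hT
  have hWr : volterraWeight (neumannCoeff V E) r ≤ volterraWeight (neumannCoeff V 0) T + E * T ^ 2 / 2 :=
    (volterraWeight_mono hIE hr.2 le_rfl).trans (volterraWeight_neumannCoeff_le hV hV3 hE hT)
  have h1 : Real.exp (volterraWeight (neumannCoeff V E') T) * Real.exp (volterraWeight (neumannCoeff V E) r) ≤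
      Real.exp (2 * volterraWeight (neumannCoeff V 0) T + (E + E') * T ^ 2 / 2) := by
    rw [← Real.exp_add]
    exact Real.exp_le_exp.2 (by linarith)
  have h2 : 0 ≤ |E - E'| * (T ^ 2 / 2) * r := by have := hr.1; positivity
  calc Real.exp (volterraWeight (neumannCoeff V E') T) * (|E - E'| * (T ^ 2 / 2)) *
        (r * Real.exp (volterraWeight (neumannCoeff V E) r))
      = (Real.exp (volterraWeight (neumannCoeff V E') T) * Real.exp (volterraWeight (neumannCoeff V E) r)) *
          (|E - E'| * (T ^ 2 / 2) * r) := by ring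
    _ ≤ Real.exp (2 * volterraWeight (neumannCoeff V 0) T + (E + E') * T ^ 2 / 2) * (|E - E'| * (T ^ 2 / 2) * r) :=
        mul_le_mul_of_nonneg_right h1 h2
    _ = _ := by ring

/-- **Energy dependence of `m_E'` on `[0, T]`**: for `0 ≤ E, E'`,
`|m_E'(r) - m_{E'}'(r)| ≤ C'_T |E - E'|`. [folklore] -/
theorem abs_neumannRadialDeriv_sub_le {E E' T : ℝ} (hE : 0 ≤ E) (hE' : 0 ≤ E') (hT : 0 ≤ T) {r : ℝ}
    (hr : r ∈ Icc 0 T) :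
    |volterraDeriv (neumannCoeff V E) r - volterraDeriv (neumannCoeff V E') r| ≤
      Real.exp (2 * volterraWeight (neumannCoeff V 0) T + (E + E') * T ^ 2 / 2) * (T ^ 2 / 2) *
        (1 + (volterraWeight (neumannCoeff V 0) T + E * T ^ 2 / 2)) * |E - E'| := by
  have hIE := integrableOn_id_mul_neumannCoeff hV hV3 E T
  have hIE' := integrableOn_id_mul_neumannCoeff hV hV3 E' T
  have h := abs_volterraDeriv_sub_volterraDeriv_le hIE hIE' hr
  have hδ : ∫ s in Ioc 0 T, s * |neumannCoeff V E s - neumannCoeff V E' s| = |E - E'| * (T ^ 2 / 2) := by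
    simp only [neumannCoeff_sub, abs_sub_comm E' E]
    rw [integral_mul_const, ← intervalIntegral.integral_of_le hT, integral_id]
    ring
  rw [hδ] at h
  refine h.trans ?_
  set W := volterraWeight (neumannCoeff V 0) T with hWdef
  have hW' := volterraWeight_neumannCoeff_le hV hV3 hE' hT
  have hW := volterraWeight_neumannCoeff_le hV hV3 hE hT
  have hWE0 := volterraWeight_nonneg (neumannCoeff V E) T
  -- `e^{G_E'} ≤ e^{W + E'T²/2}`, `G_E e^{G_E} ≤ (W + ET²/2) e^{W + ET²/2}`
  have h1 : Real.exp (volterraWeight (neumannCoeff V E') T) ≤ Real.exp (W + E' * T ^ 2 / 2) :=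
    Real.exp_le_exp.2 hW'
  have h2 : volterraWeight (neumannCoeff V E) T * Real.exp (volterraWeight (neumannCoeff V E) T) ≤
      (W + E * T ^ 2 / 2) * Real.exp (W + E * T ^ 2 / 2) :=
    mul_le_mul hW (Real.exp_le_exp.2 hW) (Real.exp_nonneg _) (hWE0.trans hW)
  have h3 : 0 ≤ |E - E'| * (T ^ 2 / 2) := by positivity
  calc Real.exp (volterraWeight (neumannCoeff V E') T) * (|E - E'| * (T ^ 2 / 2)) *
        (1 + volterraWeight (neumannCoeff V E) T * Real.exp (volterraWeight (neumannCoeff V E) T))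
      ≤ Real.exp (W + E' * T ^ 2 / 2) * (|E - E'| * (T ^ 2 / 2)) *
        (1 + (W + E * T ^ 2 / 2) * Real.exp (W + E * T ^ 2 / 2)) := by
        gcongr
    _ ≤ Real.exp (W + E' * T ^ 2 / 2) * (|E - E'| * (T ^ 2 / 2)) *
        ((1 + (W + E * T ^ 2 / 2)) * Real.exp (W + E * T ^ 2 / 2)) := by
        gcongr
        have h4 : 1 ≤ Real.exp (W + E * T ^ 2 / 2) := Real.one_le_exp (hWE0.trans hW)
        nlinarith [Real.exp_nonneg (W + E * T ^ 2 / 2), hWE0.trans hW]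
    _ = Real.exp (2 * W + (E + E') * T ^ 2 / 2) * (T ^ 2 / 2) * (1 + (W + E * T ^ 2 / 2)) * |E - E'| := by
        have : Real.exp (2 * W + (E + E') * T ^ 2 / 2) = Real.exp (W + E' * T ^ 2 / 2) * Real.exp (W + E * T ^ 2 / 2) := by
          rw [← Real.exp_add]; ring_nf
        rw [this]; ring

omit hV hV3 in
/-- A function with a local Lipschitz bound at `E₀` from within `[0, E₀ + 1]` is continuous at `E₀`
within `[0, ∞)`. [folklore] -/
theorem continuousWithinAt_Ici_of_lipschitz {f : ℝ → ℝ} {E₀ K : ℝ} (hK : 0 ≤ K)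
    (h : ∀ E, 0 ≤ E → E ≤ E₀ + 1 → |f E - f E₀| ≤ K * |E - E₀|) :
    ContinuousWithinAt f (Ici 0) E₀ := by
  rw [Metric.continuousWithinAt_iff]
  intro ε hε
  refine ⟨min 1 (ε / (K + 1)), by positivity, fun E hE hdist => ?_⟩
  have hE0 : 0 ≤ E := hE
  rw [Real.dist_eq] at hdist ⊢
  have hE1 : E ≤ E₀ + 1 := by
    have := (abs_sub_lt_iff.1 (lt_of_lt_of_le hdist (min_le_left _ _))).1; linarith
  have h6 : |E - E₀| < ε / (K + 1) := lt_of_lt_of_le hdist (min_le_right _ _)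
  calc |f E - f E₀| ≤ K * |E - E₀| := h E hE0 hE1
    _ ≤ (K + 1) * |E - E₀| := by nlinarith [abs_nonneg (E - E₀)]
    _ < (K + 1) * (ε / (K + 1)) := by gcongr
    _ = ε := by field_simp

/-- **`m_E(r)` is continuous in `E ≥ 0`** (at fixed `r ∈ [0, T]`). [folklore] -/
theorem continuousOn_neumannRadial_energy {T r : ℝ} (hT : 0 ≤ T) (hr : r ∈ Icc 0 T) :
    ContinuousOn (fun E => volterraSol (neumannCoeff V E) r) (Ici 0) := by
  intro E₀ hE₀
  have hE₀' : 0 ≤ E₀ := hE₀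
  set W := volterraWeight (neumannCoeff V 0) T with hW
  set K : ℝ := Real.exp (2 * W + (E₀ + 1 + E₀) * T ^ 2 / 2) * (T ^ 2 / 2) * T with hK
  refine continuousWithinAt_Ici_of_lipschitz (f := fun E => volterraSol (neumannCoeff V E) r) (K := K) (by positivity)
    fun E hE0 hE1 => ?_
  have h := abs_neumannRadial_sub_le hV hV3 hE0 hE₀' hT hr
  refine h.trans ?_
  have h3 : Real.exp (2 * W + (E + E₀) * T ^ 2 / 2) ≤ Real.exp (2 * W + (E₀ + 1 + E₀) * T ^ 2 / 2) :=
    Real.exp_le_exp.2 (by nlinarith [sq_nonneg T])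
  have h4 : 0 ≤ |E - E₀| := abs_nonneg _
  calc Real.exp (2 * W + (E + E₀) * T ^ 2 / 2) * (T ^ 2 / 2) * |E - E₀| * r
      = (Real.exp (2 * W + (E + E₀) * T ^ 2 / 2) * r) * ((T ^ 2 / 2) * |E - E₀|) := by ring
    _ ≤ (Real.exp (2 * W + (E₀ + 1 + E₀) * T ^ 2 / 2) * T) * ((T ^ 2 / 2) * |E - E₀|) :=
        mul_le_mul_of_nonneg_right (mul_le_mul h3 hr.2 hr.1 (Real.exp_nonneg _)) (by positivity)
    _ = K * |E - E₀| := by rw [hK]; ring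

/-- **`m_E'(r)` is continuous in `E ≥ 0`** (at fixed `r ∈ [0, T]`). [folklore] -/
theorem continuousOn_neumannRadialDeriv_energy {T r : ℝ} (hT : 0 ≤ T) (hr : r ∈ Icc 0 T) :
    ContinuousOn (fun E => volterraDeriv (neumannCoeff V E) r) (Ici 0) := by
  intro E₀ hE₀
  have hE₀' : 0 ≤ E₀ := hE₀
  set W := volterraWeight (neumannCoeff V 0) T with hW
  have hW0 : 0 ≤ W := volterraWeight_nonneg _ _
  have hT2 : 0 ≤ T ^ 2 := sq_nonneg T
  set K : ℝ := Real.exp (2 * W + (E₀ + 1 + E₀) * T ^ 2 / 2) * (T ^ 2 / 2) * (1 + (W + (E₀ + 1) * T ^ 2 / 2))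
    with hK
  have hK0 : 0 ≤ K := by
    have h1 : 0 ≤ 1 + (W + (E₀ + 1) * T ^ 2 / 2) := by nlinarith
    rw [hK]
    exact mul_nonneg (mul_nonneg (Real.exp_nonneg _) (by positivity)) h1
  refine continuousWithinAt_Ici_of_lipschitz (f := fun E => volterraDeriv (neumannCoeff V E) r) (K := K) hK0
    fun E hE0 hE1 => ?_
  have h := abs_neumannRadialDeriv_sub_le hV hV3 hE0 hE₀' hT hr
  refine h.trans ?_
  have h3 : Real.exp (2 * W + (E + E₀) * T ^ 2 / 2) ≤ Real.exp (2 * W + (E₀ + 1 + E₀) * T ^ 2 / 2) :=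
    Real.exp_le_exp.2 (by nlinarith)
  have h5 : 1 + (W + E * T ^ 2 / 2) ≤ 1 + (W + (E₀ + 1) * T ^ 2 / 2) := by nlinarith
  have h6 : 0 ≤ 1 + (W + E * T ^ 2 / 2) := by nlinarith
  have h4 : 0 ≤ |E - E₀| := abs_nonneg _
  calc Real.exp (2 * W + (E + E₀) * T ^ 2 / 2) * (T ^ 2 / 2) * (1 + (W + E * T ^ 2 / 2)) * |E - E₀|
      = (Real.exp (2 * W + (E + E₀) * T ^ 2 / 2) * (1 + (W + E * T ^ 2 / 2))) * ((T ^ 2 / 2) * |E - E₀|) := by ring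
    _ ≤ (Real.exp (2 * W + (E₀ + 1 + E₀) * T ^ 2 / 2) * (1 + (W + (E₀ + 1) * T ^ 2 / 2))) * ((T ^ 2 / 2) * |E - E₀|) :=
        mul_le_mul_of_nonneg_right (mul_le_mul h3 h5 h6 (Real.exp_nonneg _)) (by positivity)
    _ = K * |E - E₀| := by rw [hK]; ring

/-- At `E = 0` the coefficient is non-negative: `u = m₀ ≥ r`, `u' ≥ 1`. [cite: LSSY2005, (2.4)] -/
theorem le_neumannRadial_zero {T r : ℝ} (hr : r ∈ Icc 0 T) : r ≤ volterraSol (neumannCoeff V 0) r :=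
  le_volterraSol (integrableOn_id_mul_neumannCoeff hV hV3 0 T) (neumannCoeff_zero_nonneg V) hr

/-- `u' ≥ 1`. [cite: LSSY2005, (2.4)] -/
theorem one_le_neumannRadialDeriv_zero {T r : ℝ} (hr : r ∈ Icc 0 T) : 1 ≤ volterraDeriv (neumannCoeff V 0) r :=
  one_le_volterraDeriv (integrableOn_id_mul_neumannCoeff hV hV3 0 T) (neumannCoeff_zero_nonneg V) hr

end Radial

/-! ### The explicit tail beyond the range: `m_E = β cos(k·) + α sin(k·)/k`, `k = √E` -/

section Tail

/-- The **model tail** `n(r) = β cos(k(r - R)) + α (r - R) sinc(k(r - R))`, `k = √E`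
(`= β cos(k(r-R)) + (α/k) sin(k(r-R))` for `E > 0`, `= β + α(r - R)` for `E = 0`): the solution of
`n'' = -E n` with `n(R) = β`, `n'(R) = α`. [cite: BoccatoEtAl2019, App. B, (B.2)] -/
def neumannTail (E α β R r : ℝ) : ℝ :=
  β * Real.cos (Real.sqrt E * (r - R)) + α * ((r - R) * Real.sinc (Real.sqrt E * (r - R)))

/-- The derivative `n'(r) = α cos(k(r - R)) - β E (r - R) sinc(k(r - R))` (`= α cos - βk sin`) of the
model tail. [cite: BoccatoEtAl2019, App. B, (B.2)] -/
def neumannTailDeriv (E α β R r : ℝ) : ℝ :=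
  α * Real.cos (Real.sqrt E * (r - R)) - β * (E * ((r - R) * Real.sinc (Real.sqrt E * (r - R))))

/-- `t sinc(kt) = sin(kt)/k` for `k ≠ 0`. [folklore] -/
theorem mul_sinc_mul {k : ℝ} (hk : k ≠ 0) (t : ℝ) : t * Real.sinc (k * t) = Real.sin (k * t) / k := by
  rcases eq_or_ne t 0 with ht | ht
  · simp [ht]
  · rw [Real.sinc_of_ne_zero (mul_ne_zero hk ht)]
    field_simp

/-- `n(R) = β`. [folklore] -/
@[simp] theorem neumannTail_self (E α β R : ℝ) : neumannTail E α β R R = β := by simp [neumannTail]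

/-- `n'(R) = α`. [folklore] -/
@[simp] theorem neumannTailDeriv_self (E α β R : ℝ) : neumannTailDeriv E α β R R = α := by simp [neumannTailDeriv]

/-- At `E = 0` the tail is affine. [folklore] -/
theorem neumannTail_zero_energy (α β R r : ℝ) : neumannTail 0 α β R r = β + α * (r - R) := by
  simp [neumannTail]

/-- At `E = 0`, `n' = α`. [folklore] -/
theorem neumannTailDeriv_zero_energy (α β R r : ℝ) : neumannTailDeriv 0 α β R r = α := by
  simp [neumannTailDeriv]

/-- **The model tail solves the restarted Volterra equation**
`n(r) = β + α(r - R) - E ∫_R^r (r - s) n(s) ds`, and `n'(r) = α - E ∫_R^r n` (`r ≥ R`).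
[cite: BoccatoEtAl2019, App. B, (B.2)] -/
theorem neumannTail_restart {E : ℝ} (hE : 0 ≤ E) (α β R : ℝ) {r : ℝ} (hr : R ≤ r) :
    neumannTail E α β R r = β + α * (r - R) + ∫ s in Ioc R r, (r - s) * (-E) * neumannTail E α β R s ∧
    neumannTailDeriv E α β R r = α + ∫ s in Ioc R r, (-E) * neumannTail E α β R s := by
  rcases hE.eq_or_lt with hE0 | hEpos
  · -- `E = 0`: everything is affine and the integrals vanish
    subst hE0
    simp [neumannTail_zero_energy, neumannTailDeriv_zero_energy]
  -- `E > 0`: `n = β cos(k·) + (α/k) sin(k·)` is smooth with `n'' = -E n`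
  set k := Real.sqrt E with hk
  have hkpos : 0 < k := Real.sqrt_pos.2 hEpos
  have hk0 : k ≠ 0 := hkpos.ne'
  have hkk : k * k = E := Real.mul_self_sqrt hE
  set N : ℝ → ℝ := fun s => β * Real.cos (k * (s - R)) + α / k * Real.sin (k * (s - R)) with hN
  set N' : ℝ → ℝ := fun s => α * Real.cos (k * (s - R)) - β * k * Real.sin (k * (s - R)) with hN'
  have hNeq : ∀ s, neumannTail E α β R s = N s := fun s => by
    simp only [neumannTail, hN, ← hk, mul_sinc_mul hk0]
    ring
  have hN'eq : ∀ s, neumannTailDeriv E α β R s = N' s := fun s => by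
    simp only [neumannTailDeriv, hN', ← hk]
    rw [mul_sinc_mul hk0, ← hkk]
    field_simp
  -- derivatives
  have hlin : ∀ s, HasDerivAt (fun s => k * (s - R)) k s := fun s => by
    simpa using ((hasDerivAt_id s).sub_const R).const_mul k
  have hcos : ∀ s, HasDerivAt (fun s => Real.cos (k * (s - R))) (-Real.sin (k * (s - R)) * k) s :=
    fun s => (Real.hasDerivAt_cos _).comp s (hlin s)
  have hsin : ∀ s, HasDerivAt (fun s => Real.sin (k * (s - R))) (Real.cos (k * (s - R)) * k) s :=
    fun s => (Real.hasDerivAt_sin _).comp s (hlin s)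
  have hdN : ∀ s, HasDerivAt N (N' s) s := fun s => by
    have h := ((hcos s).const_mul β).add ((hsin s).const_mul (α / k))
    have he : β * (-Real.sin (k * (s - R)) * k) + α / k * (Real.cos (k * (s - R)) * k) = N' s := by
      simp only [hN']; field_simp; ring
    exact h.congr_deriv he
  have hdN' : ∀ s, HasDerivAt N' (-E * N s) s := fun s => by
    have h := ((hcos s).const_mul α).sub ((hsin s).const_mul (β * k))
    have he : α * (-Real.sin (k * (s - R)) * k) - β * k * (Real.cos (k * (s - R)) * k) = -E * N s := by
      simp only [hN, ← hkk]; field_simp; ring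
    exact h.congr_deriv he
  have hNc : Continuous N := by simp only [hN]; fun_prop
  have hN'c : Continuous N' := by simp only [hN']; fun_prop
  -- first integration: `N'(s) = α - E ∫_R^s N`
  have hFTC1 : ∀ s, R ≤ s → N' s = α + ∫ t in Ioc R s, (-E) * N t := by
    intro s hs
    have h := intervalIntegral.integral_eq_sub_of_hasDerivAt (fun t _ => hdN' t)
      ((continuous_const.mul hNc).intervalIntegrable R s)
    rw [intervalIntegral.integral_of_le hs] at h
    have hR : N' R = α := by simp [hN']
    rw [h, hR]; ring
  -- second integration: `N(r) = β + ∫_R^r N'`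
  have hFTC2 : N r = β + ∫ s in Ioc R r, N' s := by
    have h := intervalIntegral.integral_eq_sub_of_hasDerivAt (fun t _ => hdN t) (hN'c.intervalIntegrable R r)
    rw [intervalIntegral.integral_of_le hr] at h
    have hR : N R = β := by simp [hN]
    rw [h, hR]; ring
  have hint : IntegrableOn (fun t => (-E) * N t) (Ioc R r) :=
    ((continuous_const.mul hNc).integrableOn_Icc (a := R) (b := r)).mono_set Ioc_subset_Icc_self
  have hprim := setIntegral_Ioc_primitive hint
  refine ⟨?_, ?_⟩
  · rw [hNeq, hFTC2, setIntegral_congr_fun measurableSet_Ioc (fun s hs => hFTC1 s hs.1.le), integral_add,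
      setIntegral_const, hprim]
    · simp only [smul_eq_mul, Real.volume_real_Ioc_of_le hr]
      rw [show (∫ t in Ioc R r, (r - t) * (-E * N t)) = ∫ s in Ioc R r, (r - s) * -E * neumannTail E α β R s from
        setIntegral_congr_fun measurableSet_Ioc fun s _ => by rw [hNeq]; ring]
      ring
    · exact integrableOn_const (by rw [Real.volume_Ioc]; exact ENNReal.ofReal_ne_top)
    · exact ((continuousOn_primitive_Ioc hint).integrableOn_compact isCompact_Icc).mono_set Ioc_subset_Icc_self
  · rw [hN'eq, hFTC1 r hr]
    congr 1
    exact setIntegral_congr_fun measurableSet_Ioc fun s _ => by rw [hNeq]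

/-- The model tail is continuous. [folklore] -/
theorem continuous_neumannTail (E α β R : ℝ) : Continuous (neumannTail E α β R) := by
  unfold neumannTail
  fun_prop

variable {V : ℝ → ℝ≥0∞} {R : ℝ}
variable (hV : Measurable V) (hV3 : ∫⁻ s in Ioi (0 : ℝ), ENNReal.ofReal (s ^ 2) * V s ^ 3 ≠ ⊤)
  (hR : 0 ≤ R) (hVR : ∀ r, R < r → V r = 0)
include hV hV3 hR hVR

/-- **The tail formula**: beyond the range of `V`, the regular radial solution at energy `E ≥ 0` is
`m_E(r) = m_E(R) cos(k(r-R)) + m_E'(R) sin(k(r-R))/k`, `k = √E` (both solve the restarted Volterra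
equation with `q_E = -E` on `(R, r]`; Grönwall). [cite: BoccatoEtAl2019, App. B, (B.2); ErdosSchleinYau2006, App. A, (A.3)] -/
theorem volterraSol_neumannCoeff_tail {E : ℝ} (hE : 0 ≤ E) {r : ℝ} (hr : R ≤ r) :
    volterraSol (neumannCoeff V E) r =
      neumannTail E (volterraDeriv (neumannCoeff V E) R) (volterraSol (neumannCoeff V E) R) R r := by
  have hI := integrableOn_id_mul_neumannCoeff hV hV3 E r
  have hmc : ContinuousOn (volterraSol (neumannCoeff V E)) (Icc 0 r) := continuousOn_volterraSol hI
  have hnc : Continuous (neumannTail E (volterraDeriv (neumannCoeff V E) R) (volterraSol (neumannCoeff V E) R) R) :=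
    continuous_neumannTail _ _ _ _
  have hhc : ContinuousOn (fun ρ => volterraSol (neumannCoeff V E) ρ -
      neumannTail E (volterraDeriv (neumannCoeff V E) R) (volterraSol (neumannCoeff V E) R) R ρ) (Icc R r) :=
    (hmc.mono (Icc_subset_Icc_left hR)).sub hnc.continuousOn
  -- the homogeneous restarted equation for the difference
  have hheq : ∀ ρ ∈ Icc R r, volterraSol (neumannCoeff V E) ρ -
      neumannTail E (volterraDeriv (neumannCoeff V E) R) (volterraSol (neumannCoeff V E) R) R ρ =
      ∫ s in Ioc R ρ, (ρ - s) * (-E) * (volterraSol (neumannCoeff V E) s -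
        neumannTail E (volterraDeriv (neumannCoeff V E) R) (volterraSol (neumannCoeff V E) R) R s) := by
    intro ρ hρ
    have h1 := volterraSol_restart hI hR hρ.1 hρ.2
    have h2 := (neumannTail_restart hE (volterraDeriv (neumannCoeff V E) R) (volterraSol (neumannCoeff V E) R) R hρ.1).1
    have hq : ∀ s ∈ Ioc R ρ, (ρ - s) * neumannCoeff V E s * volterraSol (neumannCoeff V E) s =
        (ρ - s) * (-E) * volterraSol (neumannCoeff V E) s := fun s hs => by
      rw [neumannCoeff_of_range hVR E hs.1]
    have hi1 : IntegrableOn (fun s => (ρ - s) * (-E) * volterraSol (neumannCoeff V E) s) (Ioc R ρ) := by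
      have hc : ContinuousOn (fun s => (ρ - s) * (-E) * volterraSol (neumannCoeff V E) s) (Icc R ρ) :=
        ((continuousOn_const.sub continuousOn_id).mul continuousOn_const).mul (hmc.mono (Icc_subset_Icc hR hρ.2))
      exact (hc.integrableOn_compact isCompact_Icc).mono_set Ioc_subset_Icc_self
    have hi2 : IntegrableOn (fun s => (ρ - s) * (-E) *
        neumannTail E (volterraDeriv (neumannCoeff V E) R) (volterraSol (neumannCoeff V E) R) R s) (Ioc R ρ) :=
      (Continuous.integrableOn_Icc (a := R) (b := ρ) (by fun_prop)).mono_set Ioc_subset_Icc_self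
    rw [h1, setIntegral_congr_fun measurableSet_Ioc hq, h2]
    calc volterraSol (neumannCoeff V E) R + (ρ - R) * volterraDeriv (neumannCoeff V E) R +
          (∫ s in Ioc R ρ, (ρ - s) * -E * volterraSol (neumannCoeff V E) s) -
          (volterraSol (neumannCoeff V E) R + volterraDeriv (neumannCoeff V E) R * (ρ - R) +
            ∫ s in Ioc R ρ, (ρ - s) * -E *
              neumannTail E (volterraDeriv (neumannCoeff V E) R) (volterraSol (neumannCoeff V E) R) R s)
        = (∫ s in Ioc R ρ, (ρ - s) * -E * volterraSol (neumannCoeff V E) s) -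
            ∫ s in Ioc R ρ, (ρ - s) * -E *
              neumannTail E (volterraDeriv (neumannCoeff V E) R) (volterraSol (neumannCoeff V E) R) R s := by ring
      _ = ∫ s in Ioc R ρ, ((ρ - s) * -E * volterraSol (neumannCoeff V E) s - (ρ - s) * -E *
              neumannTail E (volterraDeriv (neumannCoeff V E) R) (volterraSol (neumannCoeff V E) R) R s) :=
          (integral_sub hi1 hi2).symm
      _ = _ := setIntegral_congr_fun measurableSet_Ioc fun s _ => by ring
  -- Grönwall with the constant kernel `E (r - R)` for `ψ = |difference|`
  obtain ⟨B, hB⟩ := (isCompact_Icc.image_of_continuousOn hhc).isBounded.exists_norm_le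
  have hψm : AEStronglyMeasurable (fun ρ => |volterraSol (neumannCoeff V E) ρ -
      neumannTail E (volterraDeriv (neumannCoeff V E) R) (volterraSol (neumannCoeff V E) R) R ρ|)
      (volume.restrict (Ioc R r)) :=
    (hhc.norm.mono Ioc_subset_Icc_self).aestronglyMeasurable measurableSet_Ioc
  have hψi : IntegrableOn (fun ρ => |volterraSol (neumannCoeff V E) ρ -
      neumannTail E (volterraDeriv (neumannCoeff V E) R) (volterraSol (neumannCoeff V E) R) R ρ|) (Ioc R r) :=
    (hhc.norm.integrableOn_compact isCompact_Icc).mono_set Ioc_subset_Icc_self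
  have hψB : ∀ ρ ∈ Ioc R r, |volterraSol (neumannCoeff V E) ρ -
      neumannTail E (volterraDeriv (neumannCoeff V E) R) (volterraSol (neumannCoeff V E) R) R ρ| ≤ B :=
    fun ρ hρ => hB _ (mem_image_of_mem _ (Ioc_subset_Icc_self hρ))
  have hg : IntegrableOn (fun _ : ℝ => E * (r - R)) (Ioc R r) :=
    integrableOn_const (by rw [Real.volume_Ioc]; exact ENNReal.ofReal_ne_top)
  have hψineq : ∀ ρ ∈ Ioc R r, |volterraSol (neumannCoeff V E) ρ -
      neumannTail E (volterraDeriv (neumannCoeff V E) R) (volterraSol (neumannCoeff V E) R) R ρ| ≤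
      0 + ∫ s in Ioc R ρ, E * (r - R) * |volterraSol (neumannCoeff V E) s -
        neumannTail E (volterraDeriv (neumannCoeff V E) R) (volterraSol (neumannCoeff V E) R) R s| := by
    intro ρ hρ
    have hsub : Ioc R ρ ⊆ Ioc R r := Ioc_subset_Ioc_right hρ.2
    rw [zero_add, hheq ρ (Ioc_subset_Icc_self hρ), ← Real.norm_eq_abs]
    refine norm_integral_le_of_norm_le ((hψi.mono_set hsub).const_mul _) ?_
    filter_upwards [ae_restrict_mem measurableSet_Ioc] with s hs
    rw [Real.norm_eq_abs, abs_mul, abs_mul, abs_neg, abs_of_nonneg hE]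
    have h1 : |ρ - s| ≤ r - R := by rw [abs_of_nonneg (by linarith [hs.2])]; linarith [hs.1, hρ.2]
    have h2 := abs_nonneg (volterraSol (neumannCoeff V E) s -
      neumannTail E (volterraDeriv (neumannCoeff V E) R) (volterraSol (neumannCoeff V E) R) R s)
    calc |ρ - s| * E * |volterraSol (neumannCoeff V E) s -
          neumannTail E (volterraDeriv (neumannCoeff V E) R) (volterraSol (neumannCoeff V E) R) R s|
        ≤ (r - R) * E * |volterraSol (neumannCoeff V E) s -
          neumannTail E (volterraDeriv (neumannCoeff V E) R) (volterraSol (neumannCoeff V E) R) R s| := by gcongr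
      _ = _ := by ring
  have hG := gronwall_volterra hg (fun _ => mul_nonneg hE (by linarith)) hψm (fun ρ _ => abs_nonneg _) hψB
    le_rfl hψineq
  rcases hr.eq_or_lt with h0 | h0
  · rw [← h0, neumannTail_self]
  · have h1 := hG r ⟨h0, le_rfl⟩
    rw [zero_mul] at h1
    exact sub_eq_zero.1 (abs_eq_zero.1 (le_antisymm h1 (abs_nonneg _)))

/-- **The tail formula for the derivative**: `m_E'(r) = m_E'(R) cos(k(r-R)) - m_E(R) k sin(k(r-R))`
for `r ≥ R`. [cite: BoccatoEtAl2019, App. B, (B.2); ErdosSchleinYau2006, App. A, (A.3)] -/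
theorem volterraDeriv_neumannCoeff_tail {E : ℝ} (hE : 0 ≤ E) {r : ℝ} (hr : R ≤ r) :
    volterraDeriv (neumannCoeff V E) r =
      neumannTailDeriv E (volterraDeriv (neumannCoeff V E) R) (volterraSol (neumannCoeff V E) R) R r := by
  have hI := integrableOn_id_mul_neumannCoeff hV hV3 E r
  have hqi := integrableOn_coeff_mul_volterraSol hI
  -- `m'(r) = m'(R) + ∫_R^r q m = α - E ∫_R^r n`
  have h1 : volterraDeriv (neumannCoeff V E) r = volterraDeriv (neumannCoeff V E) R +
      ∫ s in Ioc R r, neumannCoeff V E s * volterraSol (neumannCoeff V E) s := by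
    simp only [volterraDeriv, volterraPrim]
    rw [add_assoc, ← setIntegral_union (Ioc_disjoint_Ioc_of_le le_rfl) measurableSet_Ioc
      (hqi.mono_set (Ioc_subset_Ioc_right hr)) (hqi.mono_set (Ioc_subset_Ioc_left hR)),
      Ioc_union_Ioc_eq_Ioc hR hr]
  have h2 : ∫ s in Ioc R r, neumannCoeff V E s * volterraSol (neumannCoeff V E) s =
      ∫ s in Ioc R r, (-E) * neumannTail E (volterraDeriv (neumannCoeff V E) R) (volterraSol (neumannCoeff V E) R) R s := by
    refine setIntegral_congr_fun measurableSet_Ioc fun s hs => ?_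
    rw [neumannCoeff_of_range hVR E hs.1, volterraSol_neumannCoeff_tail hV hV3 hR hVR hE hs.1.le]
  rw [h1, h2, (neumannTail_restart hE (volterraDeriv (neumannCoeff V E) R) (volterraSol (neumannCoeff V E) R) R hr).2]

end Tail

/-! ### Taylor bounds for `cos` and `sinc` on `[0, 1]` -/

section Taylor

/-- `|sinc x - (1 - x²/6)| ≤ x⁴/100` for `|x| ≤ 1` (from Mathlib's fifth-order `Real.sin_bound`).
[folklore] -/
theorem abs_sinc_sub_le {x : ℝ} (hx : |x| ≤ 1) : |Real.sinc x - (1 - x ^ 2 / 6)| ≤ x ^ 4 / 100 := by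
  rcases eq_or_ne x 0 with h0 | h0
  · subst h0; simp
  · have h := Real.sin_bound hx
    rw [Real.sinc_of_ne_zero h0]
    have h1 : Real.sin x / x - (1 - x ^ 2 / 6) = (Real.sin x - (x - x ^ 3 / 6)) / x := by
      field_simp
    rw [h1, abs_div]
    rw [div_le_iff₀ (abs_pos.2 h0)]
    calc |Real.sin x - (x - x ^ 3 / 6)| ≤ |x| ^ 5 / 100 := h
      _ = x ^ 4 / 100 * |x| := by
        have h5 : |x| ^ 4 = x ^ 4 := by rw [pow_abs]; exact abs_of_nonneg (by positivity)
        rw [pow_succ, h5]; ring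

/-- `|cos x - (1 - x²/2)| ≤ (5/96) x⁴` for `|x| ≤ 1`. [folklore] -/
theorem abs_cos_sub_le {x : ℝ} (hx : |x| ≤ 1) : |Real.cos x - (1 - x ^ 2 / 2)| ≤ 5 / 96 * x ^ 4 := by
  have h := Real.cos_bound hx
  rw [show |x| ^ 4 = x ^ 4 by rw [pow_abs, abs_of_nonneg (by positivity)]] at h
  linarith

/-- **The two tail combinations to second order.** For `0 ≤ E`, `D, L ≥ 0`, `D ≤ L`, `E D² ≤ 1`,
with `x = √E D`:
`|(L cos x - D sinc x) - (L - D - E D²(3L - D)/6)| ≤ E² D⁴ L/16` and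
`|(cos x + E L D sinc x) - (1 + E D (L - D/2))| ≤ E² L D³/4`. [folklore] -/
theorem abs_tail_combinations_le {E D L : ℝ} (hE : 0 ≤ E) (hD : 0 ≤ D) (hDL : D ≤ L) (hED : E * D ^ 2 ≤ 1) :
    |(L * Real.cos (Real.sqrt E * D) - D * Real.sinc (Real.sqrt E * D)) - (L - D - E * D ^ 2 * (3 * L - D) / 6)| ≤
        E ^ 2 * D ^ 4 * L / 16 ∧
    |(Real.cos (Real.sqrt E * D) + E * L * D * Real.sinc (Real.sqrt E * D)) - (1 + E * D * (L - D / 2))| ≤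
        E ^ 2 * L * D ^ 3 / 4 := by
  set x := Real.sqrt E * D with hxdef
  have hx0 : 0 ≤ x := mul_nonneg (Real.sqrt_nonneg _) hD
  have hx2 : x ^ 2 = E * D ^ 2 := by rw [hxdef, mul_pow, Real.sq_sqrt hE]
  have hx4 : x ^ 4 = E ^ 2 * D ^ 4 := by
    calc x ^ 4 = (x ^ 2) ^ 2 := by ring
      _ = E ^ 2 * D ^ 4 := by rw [hx2]; ring
  have hxle : |x| ≤ 1 := by
    rw [abs_of_nonneg hx0]
    have : x ^ 2 ≤ 1 := by rw [hx2]; exact hED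
    nlinarith
  set c := Real.cos x - (1 - x ^ 2 / 2) with hc
  set σ := Real.sinc x - (1 - x ^ 2 / 6) with hσ
  have hcb : |c| ≤ 5 / 96 * x ^ 4 := abs_cos_sub_le hxle
  have hσb : |σ| ≤ x ^ 4 / 100 := abs_sinc_sub_le hxle
  have hcos : Real.cos x = 1 - x ^ 2 / 2 + c := by rw [hc]; ring
  have hsinc : Real.sinc x = 1 - x ^ 2 / 6 + σ := by rw [hσ]; ring
  have hL0 : 0 ≤ L := hD.trans hDL
  constructor
  · have h1 : (L * Real.cos x - D * Real.sinc x) - (L - D - E * D ^ 2 * (3 * L - D) / 6) = L * c - D * σ := by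
      rw [hcos, hsinc, hx2]; ring
    rw [h1]
    calc |L * c - D * σ| ≤ |L * c| + |D * σ| := abs_sub _ _
      _ = L * |c| + D * |σ| := by rw [abs_mul, abs_mul, abs_of_nonneg hL0, abs_of_nonneg hD]
      _ ≤ L * (5 / 96 * x ^ 4) + L * (x ^ 4 / 100) :=
          add_le_add (mul_le_mul_of_nonneg_left hcb hL0)
            ((mul_le_mul_of_nonneg_left hσb hD).trans (mul_le_mul_of_nonneg_right hDL (by positivity)))
      _ ≤ E ^ 2 * D ^ 4 * L / 16 := by rw [hx4]; nlinarith [sq_nonneg E, sq_nonneg D, pow_nonneg hD 4, sq_nonneg (E * D ^ 2)]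
  · have h1 : (Real.cos x + E * L * D * Real.sinc x) - (1 + E * D * (L - D / 2)) =
        c - E ^ 2 * L * D ^ 3 / 6 + E * L * D * σ := by
      rw [hcos, hsinc, hx2]; ring
    rw [h1]
    have hE2 := sq_nonneg E
    have hD3 : 0 ≤ D ^ 3 := by positivity
    have hELD : 0 ≤ E * L * D := by positivity
    have h2 : |c| ≤ 5 / 96 * (E ^ 2 * L * D ^ 3) := by
      refine hcb.trans ?_
      rw [hx4]
      have : E ^ 2 * D ^ 4 ≤ E ^ 2 * L * D ^ 3 := by
        calc E ^ 2 * D ^ 4 = E ^ 2 * D * D ^ 3 := by ring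
          _ ≤ E ^ 2 * L * D ^ 3 := by gcongr
      linarith
    have h3 : |E * L * D * σ| ≤ E ^ 2 * L * D ^ 3 / 100 := by
      rw [abs_mul, abs_of_nonneg hELD]
      calc E * L * D * |σ| ≤ E * L * D * (x ^ 4 / 100) := mul_le_mul_of_nonneg_left hσb hELD
        _ = E ^ 2 * L * D ^ 3 / 100 * (E * D ^ 2) := by rw [hx4]; ring
        _ ≤ E ^ 2 * L * D ^ 3 / 100 * 1 := by gcongr
        _ = _ := by ring
    have h4 : |E ^ 2 * L * D ^ 3 / 6| = E ^ 2 * L * D ^ 3 / 6 := abs_of_nonneg (by positivity)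
    calc |c - E ^ 2 * L * D ^ 3 / 6 + E * L * D * σ|
        ≤ |c| + |E ^ 2 * L * D ^ 3 / 6| + |E * L * D * σ| := by
          calc _ ≤ |c - E ^ 2 * L * D ^ 3 / 6| + |E * L * D * σ| := abs_add_le _ _
            _ ≤ _ := by gcongr; exact abs_sub _ _
      _ ≤ 5 / 96 * (E ^ 2 * L * D ^ 3) + E ^ 2 * L * D ^ 3 / 6 + E ^ 2 * L * D ^ 3 / 100 := by
          rw [h4]; gcongr
      _ ≤ E ^ 2 * L * D ^ 3 / 4 := by nlinarith [mul_nonneg (mul_nonneg hE2 hL0) hD3]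

end Taylor

/-! ### The Neumann boundary function, the scattering length and the lowest Neumann eigenvalue -/

section Eigenvalue

/-- The **Neumann boundary defect** `g(E) = L m_E'(L) - m_E(L)` (`= L² (m_E/r)'(L)`): `E` is a
Neumann eigenvalue of `-Δ + ½V` on the ball of radius `L` with regular radial eigenfunction
`m_E(r)/r` iff `g(E) = 0`. [cite: BastiCenatiempoSchlein2021, (2.4); ErdosSchleinYau2006, App. A, (A.2)] -/
def neumannBdry (V : ℝ → ℝ≥0∞) (L E : ℝ) : ℝ :=
  L * volterraDeriv (neumannCoeff V E) L - volterraSol (neumannCoeff V E) L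

/-- The **scattering length from the regular zero-energy solution** of a (possibly unbounded)
radial profile, read at a radius `R` beyond the range: `a = R - u(R)/u'(R)`
(`u(r) = u'(R)(r - a)` for `r ≥ R`). For bounded profiles this is the tree's `odeScatteringLength`
(`odeScatteringLength_eq_volterra`). [cite: LSSY2005, (2.5)] -/
def volterraScatteringLength (V : ℝ → ℝ≥0∞) (R : ℝ) : ℝ :=
  R - volterraSol (neumannCoeff V 0) R / volterraDeriv (neumannCoeff V 0) R

/-- The **lowest Neumann eigenvalue** `λ_ℓ` of `-Δ + ½V` on the ball `|x| ≤ L`: the least `E ≥ 0`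
with `g(E) = 0` (for `L` large it exists, lies in `[0, 1/(4(L-R)²)]`, and its eigenfunction
`f_ℓ = m_λ(r)/r` is positive — the ground state). [cite: BastiCenatiempoSchlein2021, (2.4) and Lemma 2.1;
BoccatoEtAl2019, (4.1) and Lemma 4.1; ErdosSchleinYau2006, Lemma A.1] -/
def neumannEigenvalue (V : ℝ → ℝ≥0∞) (L : ℝ) : ℝ :=
  sInf {E : ℝ | 0 ≤ E ∧ neumannBdry V L E = 0}

variable {V : ℝ → ℝ≥0∞} {R : ℝ}

/-- **`g(E)` through the data at `R`**: for `E ≥ 0` and `L ≥ R`, with `α = m_E'(R)`, `β = m_E(R)`,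
`D = L - R`, `x = √E D`: `g(E) = α(L cos x - D sinc x) - β(cos x + E L D sinc x)`.
[cite: ErdosSchleinYau2006, App. A, (A.3); BoccatoEtAl2019, App. B, (B.2)] -/
theorem neumannBdry_eq (hV : Measurable V) (hV3 : ∫⁻ s in Ioi (0 : ℝ), ENNReal.ofReal (s ^ 2) * V s ^ 3 ≠ ⊤)
    (hR : 0 ≤ R) (hVR : ∀ r, R < r → V r = 0) {E : ℝ} (hE : 0 ≤ E) {L : ℝ} (hL : R ≤ L) :
    neumannBdry V L E =
      volterraDeriv (neumannCoeff V E) R * (L * Real.cos (Real.sqrt E * (L - R)) - (L - R) * Real.sinc (Real.sqrt E * (L - R))) -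
      volterraSol (neumannCoeff V E) R * (Real.cos (Real.sqrt E * (L - R)) +
        E * L * (L - R) * Real.sinc (Real.sqrt E * (L - R))) := by
  rw [neumannBdry, volterraSol_neumannCoeff_tail hV hV3 hR hVR hE hL, volterraDeriv_neumannCoeff_tail hV hV3 hR hVR hE hL]
  simp only [neumannTail, neumannTailDeriv]
  ring

/-- At `E = 0`: `g(0) = u'(R) R - u(R) = u'(R)·a`. [cite: LSSY2005, (2.5)] -/
theorem neumannBdry_zero (hV : Measurable V) (hV3 : ∫⁻ s in Ioi (0 : ℝ), ENNReal.ofReal (s ^ 2) * V s ^ 3 ≠ ⊤)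
    (hR : 0 ≤ R) (hVR : ∀ r, R < r → V r = 0) {L : ℝ} (hL : R ≤ L) :
    neumannBdry V L 0 = volterraDeriv (neumannCoeff V 0) R * R - volterraSol (neumannCoeff V 0) R := by
  rw [neumannBdry_eq hV hV3 hR hVR le_rfl hL]
  simp

variable (hV : Measurable V) (hV3 : ∫⁻ s in Ioi (0 : ℝ), ENNReal.ofReal (s ^ 2) * V s ^ 3 ≠ ⊤)
include hV hV3

/-- `u'(R) ≥ 1`, `R ≤ u(R) ≤ R u'(R)`. [cite: LSSY2005, (2.4)–(2.5)] -/
theorem zeroEnergy_data_bounds (hR : 0 < R) :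
    1 ≤ volterraDeriv (neumannCoeff V 0) R ∧ R ≤ volterraSol (neumannCoeff V 0) R ∧
      volterraSol (neumannCoeff V 0) R ≤ R * volterraDeriv (neumannCoeff V 0) R := by
  have hI := integrableOn_id_mul_neumannCoeff hV hV3 0 R
  have hRm : R ∈ Icc 0 R := ⟨hR.le, le_rfl⟩
  exact ⟨one_le_volterraDeriv hI (neumannCoeff_zero_nonneg V) hRm,
    le_volterraSol hI (neumannCoeff_zero_nonneg V) hRm,
    volterraSol_le_mul_volterraDeriv hI (neumannCoeff_zero_nonneg V) hRm⟩

/-- **`0 ≤ a < R`.** [cite: LSSY2005, App. C, Thm. C.1] -/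
theorem volterraScatteringLength_mem (hR : 0 < R) : volterraScatteringLength V R ∈ Ico 0 R := by
  obtain ⟨h1, h2, h3⟩ := zeroEnergy_data_bounds hV hV3 hR
  have hα : 0 < volterraDeriv (neumannCoeff V 0) R := by linarith
  simp only [volterraScatteringLength, mem_Ico]
  constructor
  · rw [sub_nonneg, div_le_iff₀ hα]; linarith
  · have : 0 < volterraSol (neumannCoeff V 0) R / volterraDeriv (neumannCoeff V 0) R := div_pos (by linarith) hα
    linarith

/-- `g(0) = u'(R) a ≥ 0`. [cite: LSSY2005, (2.5)] -/
theorem neumannBdry_zero_eq (hR : 0 < R) (hVR : ∀ r, R < r → V r = 0) {L : ℝ} (hL : R ≤ L) :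
    neumannBdry V L 0 = volterraDeriv (neumannCoeff V 0) R * volterraScatteringLength V R := by
  obtain ⟨h1, -, -⟩ := zeroEnergy_data_bounds hV hV3 hR
  rw [neumannBdry_zero hV hV3 hR.le hVR hL, volterraScatteringLength]
  field_simp

/-- `g(0) ≥ 0`. [cite: LSSY2005, (2.5)] -/
theorem neumannBdry_zero_nonneg (hR : 0 < R) (hVR : ∀ r, R < r → V r = 0) {L : ℝ} (hL : R ≤ L) :
    0 ≤ neumannBdry V L 0 := by
  rw [neumannBdry_zero_eq hV hV3 hR hVR hL]
  exact mul_nonneg (by linarith [(zeroEnergy_data_bounds hV hV3 hR).1])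
    (volterraScatteringLength_mem hV hV3 hR).1

/-- `g` is continuous on `E ≥ 0`. [folklore] -/
theorem continuousOn_neumannBdry {L : ℝ} (hL : 0 ≤ L) : ContinuousOn (neumannBdry V L) (Ici 0) := by
  have hLm : L ∈ Icc 0 L := ⟨hL, le_rfl⟩
  exact (continuousOn_const.mul (continuousOn_neumannRadialDeriv_energy hV hV3 hL hLm)).sub
    (continuousOn_neumannRadial_energy hV hV3 hL hLm)

/-- The zero set `{E ≥ 0 : g(E) = 0}` is closed. [folklore] -/
theorem isClosed_neumannZeroSet {L : ℝ} (hL : 0 ≤ L) : IsClosed {E : ℝ | 0 ≤ E ∧ neumannBdry V L E = 0} := by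
  have h := (continuousOn_neumannBdry hV hV3 hL).preimage_isClosed_of_isClosed isClosed_Ici
    (isClosed_singleton (x := (0 : ℝ)))
  convert h using 1
  ext E
  simp [mem_Ici]

/-! #### Perturbation in the energy on `[0, R]` -/

/-- The constant `C₁ = e^{2W + R²/2} R²/2`, `W = ∫₀ᴿ s ½V`, of the bound `|m_E(r) - u(r)| ≤ C₁ E r`.
[folklore] -/
def pertC₁ (V : ℝ → ℝ≥0∞) (R : ℝ) : ℝ :=
  Real.exp (2 * volterraWeight (neumannCoeff V 0) R + R ^ 2 / 2) * (R ^ 2 / 2)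

/-- The constant `C₂ = C₁ (1 + W + R²/2)` of the bound `|m_E'(r) - u'(r)| ≤ C₂ E`. [folklore] -/
def pertC₂ (V : ℝ → ℝ≥0∞) (R : ℝ) : ℝ :=
  pertC₁ V R * (1 + (volterraWeight (neumannCoeff V 0) R + R ^ 2 / 2))

omit hV hV3 in
/-- `C₁ ≥ 0`. [folklore] -/
theorem pertC₁_nonneg : 0 ≤ pertC₁ V R := by unfold pertC₁; positivity

omit hV hV3 in
/-- `C₂ ≥ 0`. [folklore] -/
theorem pertC₂_nonneg : 0 ≤ pertC₂ V R := by
  unfold pertC₂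
  have := volterraWeight_nonneg (neumannCoeff V 0) R
  exact mul_nonneg pertC₁_nonneg (by positivity)

/-- **`|m_E(r) - u(r)| ≤ C₁ E r`** for `0 ≤ E ≤ 1`, `r ∈ [0, R]`. [folklore] -/
theorem abs_sub_zeroEnergy_le (hR : 0 ≤ R) {E : ℝ} (hE : 0 ≤ E) (hE1 : E ≤ 1) {r : ℝ} (hr : r ∈ Icc 0 R) :
    |volterraSol (neumannCoeff V E) r - volterraSol (neumannCoeff V 0) r| ≤ pertC₁ V R * E * r := by
  have h := abs_neumannRadial_sub_le hV hV3 hE le_rfl hR hr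
  rw [add_zero, sub_zero, abs_of_nonneg hE] at h
  refine h.trans ?_
  unfold pertC₁
  have h1 : Real.exp (2 * volterraWeight (neumannCoeff V 0) R + E * R ^ 2 / 2) ≤
      Real.exp (2 * volterraWeight (neumannCoeff V 0) R + R ^ 2 / 2) := Real.exp_le_exp.2 (by nlinarith [sq_nonneg R])
  have h2 : 0 ≤ R ^ 2 / 2 * E * r := by have := hr.1; positivity
  calc _ = Real.exp (2 * volterraWeight (neumannCoeff V 0) R + E * R ^ 2 / 2) * (R ^ 2 / 2 * E * r) := by ring
    _ ≤ Real.exp (2 * volterraWeight (neumannCoeff V 0) R + R ^ 2 / 2) * (R ^ 2 / 2 * E * r) :=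
        mul_le_mul_of_nonneg_right h1 h2
    _ = _ := by ring

/-- **`|m_E'(r) - u'(r)| ≤ C₂ E`** for `0 ≤ E ≤ 1`, `r ∈ [0, R]`. [folklore] -/
theorem abs_deriv_sub_zeroEnergy_le (hR : 0 ≤ R) {E : ℝ} (hE : 0 ≤ E) (hE1 : E ≤ 1) {r : ℝ} (hr : r ∈ Icc 0 R) :
    |volterraDeriv (neumannCoeff V E) r - volterraDeriv (neumannCoeff V 0) r| ≤ pertC₂ V R * E := by
  have h := abs_neumannRadialDeriv_sub_le hV hV3 hE le_rfl hR hr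
  rw [add_zero, sub_zero, abs_of_nonneg hE] at h
  refine h.trans ?_
  unfold pertC₂ pertC₁
  set W := volterraWeight (neumannCoeff V 0) R
  have hW : 0 ≤ W := volterraWeight_nonneg _ _
  have h1 : Real.exp (2 * W + E * R ^ 2 / 2) ≤ Real.exp (2 * W + R ^ 2 / 2) := Real.exp_le_exp.2 (by nlinarith [sq_nonneg R])
  have h2 : 1 + (W + E * R ^ 2 / 2) ≤ 1 + (W + R ^ 2 / 2) := by nlinarith [sq_nonneg R]
  have h3 : 0 ≤ 1 + (W + E * R ^ 2 / 2) := by positivity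
  calc Real.exp (2 * W + E * R ^ 2 / 2) * (R ^ 2 / 2) * (1 + (W + E * R ^ 2 / 2)) * E
      = (Real.exp (2 * W + E * R ^ 2 / 2) * (1 + (W + E * R ^ 2 / 2))) * (R ^ 2 / 2 * E) := by ring
    _ ≤ (Real.exp (2 * W + R ^ 2 / 2) * (1 + (W + R ^ 2 / 2))) * (R ^ 2 / 2 * E) :=
        mul_le_mul_of_nonneg_right (mul_le_mul h1 h2 h3 (Real.exp_nonneg _)) (by positivity)
    _ = _ := by ring

/-- **Data at `R` on the window**: for `0 ≤ E ≤ 1` with `C₁E ≤ ½`, `C₂E ≤ ½`: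
`m_E'(R) ≥ ½`, `m_E(R) ≥ R/2`, hence `b_E = m_E(R)/m_E'(R) ≥ 0`. [folklore] -/
theorem window_data_bounds (hR : 0 < R) {E : ℝ} (hE : 0 ≤ E) (hE1 : E ≤ 1) (h1 : pertC₁ V R * E ≤ 1 / 2)
    (h2 : pertC₂ V R * E ≤ 1 / 2) :
    1 / 2 ≤ volterraDeriv (neumannCoeff V E) R ∧ R / 2 ≤ volterraSol (neumannCoeff V E) R := by
  obtain ⟨hα₀, hβ₀, -⟩ := zeroEnergy_data_bounds hV hV3 hR
  have hRm : R ∈ Icc 0 R := ⟨hR.le, le_rfl⟩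
  have ha := abs_deriv_sub_zeroEnergy_le hV hV3 hR.le hE hE1 hRm
  have hb := abs_sub_zeroEnergy_le hV hV3 hR.le hE hE1 hRm
  rw [abs_le] at ha hb
  constructor
  · linarith [ha.1]
  · nlinarith [hb.1, hR]

end Eigenvalue

/-! ### Existence of the lowest Neumann eigenvalue in the window `[0, 1/(4(L-R)²)]` -/

section Existence

variable {V : ℝ → ℝ≥0∞} {R : ℝ}

/-- The **threshold radius** `L₀ = R + max(16R, C₁ + C₂ + 1)` beyond which the window analysis of
the Neumann problem applies ("for `N` large enough" in [BastiCenatiempoSchlein2021, Lemma 2.1]).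
[folklore] -/
def neumannThreshold (V : ℝ → ℝ≥0∞) (R : ℝ) : ℝ :=
  R + max (16 * R) (pertC₁ V R + pertC₂ V R + 1)

/-- The **energy window** `E₁ = 1/(4(L-R)²)` (so that `√E (L - R) ≤ ½` for `E ≤ E₁`). [folklore] -/
def neumannWindow (R L : ℝ) : ℝ := 1 / (4 * (L - R) ^ 2)

/-- Unpacking `L ≥ L₀`: `D = L - R ≥ 1`, `D ≥ 16R`, `D ≥ C₁ + C₂ + 1`. [folklore] -/
theorem threshold_le_iff_aux {L : ℝ} (hL : neumannThreshold V R ≤ L) :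
    16 * R ≤ L - R ∧ pertC₁ V R + pertC₂ V R + 1 ≤ L - R := by
  unfold neumannThreshold at hL
  constructor
  · linarith [le_max_left (16 * R) (pertC₁ V R + pertC₂ V R + 1)]
  · linarith [le_max_right (16 * R) (pertC₁ V R + pertC₂ V R + 1)]

/-- `L ≥ L₀` gives `L - R ≥ 1`. [folklore] -/
theorem one_le_sub_of_threshold {L : ℝ} (hL : neumannThreshold V R ≤ L) : 1 ≤ L - R := by
  have h := (threshold_le_iff_aux hL).2
  linarith [pertC₁_nonneg (V := V) (R := R), pertC₂_nonneg (V := V) (R := R)]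

/-- `E₁ > 0`. [folklore] -/
theorem neumannWindow_pos {L : ℝ} (hL : neumannThreshold V R ≤ L) : 0 < neumannWindow R L := by
  unfold neumannWindow
  have := one_le_sub_of_threshold hL
  positivity

/-- `E₁ ≤ 1`. [folklore] -/
theorem neumannWindow_le_one {L : ℝ} (hL : neumannThreshold V R ≤ L) : neumannWindow R L ≤ 1 := by
  unfold neumannWindow
  have h := one_le_sub_of_threshold hL
  rw [div_le_one (by positivity)]
  nlinarith

/-- `√E₁ (L - R) = ½`. [folklore] -/
theorem sqrt_neumannWindow_mul {L : ℝ} (hL : neumannThreshold V R ≤ L) :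
    Real.sqrt (neumannWindow R L) * (L - R) = 1 / 2 := by
  have h := one_le_sub_of_threshold hL
  have hD : 0 < L - R := by linarith
  unfold neumannWindow
  rw [show 1 / (4 * (L - R) ^ 2) = (1 / (2 * (L - R))) ^ 2 by field_simp; ring, Real.sqrt_sq (by positivity)]
  field_simp

/-- On the window, `E (L-R)² ≤ ¼` and `√E (L-R) ≤ ½`. [folklore] -/
theorem window_mul_sq_le {L E : ℝ} (hL : neumannThreshold V R ≤ L) (hE : 0 ≤ E) (hE1 : E ≤ neumannWindow R L) :
    E * (L - R) ^ 2 ≤ 1 / 4 ∧ Real.sqrt E * (L - R) ≤ 1 / 2 := by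
  have h := one_le_sub_of_threshold hL
  have hD : 0 < L - R := by linarith
  have h1 : E * (L - R) ^ 2 ≤ 1 / 4 := by
    unfold neumannWindow at hE1
    rw [le_div_iff₀ (by positivity)] at hE1
    linarith
  refine ⟨h1, ?_⟩
  have h2 : (Real.sqrt E * (L - R)) ^ 2 ≤ 1 / 4 := by
    rw [mul_pow, Real.sq_sqrt hE]; linarith
  nlinarith [h2, mul_nonneg (Real.sqrt_nonneg E) hD.le]

/-- On the window the perturbation is small: `C₁E ≤ ¼`, `C₂E ≤ ¼`, `E ≤ 1`. [folklore] -/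
theorem window_pert_small {L E : ℝ} (hL : neumannThreshold V R ≤ L) (hE : 0 ≤ E) (hE1 : E ≤ neumannWindow R L) :
    pertC₁ V R * E ≤ 1 / 4 ∧ pertC₂ V R * E ≤ 1 / 4 ∧ E ≤ 1 := by
  have h := one_le_sub_of_threshold hL
  obtain ⟨-, hC⟩ := threshold_le_iff_aux hL
  have hC₁ := pertC₁_nonneg (V := V) (R := R)
  have hC₂ := pertC₂_nonneg (V := V) (R := R)
  have hD : 0 < L - R := by linarith
  have hEle : E ≤ 1 / (4 * (L - R) ^ 2) := hE1
  -- `E ≤ 1/(4D²) ≤ 1/(4D)` since `D ≥ 1`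
  have hE2 : E * (4 * (L - R)) ≤ 1 := by
    rw [le_div_iff₀ (by positivity)] at hEle
    nlinarith
  refine ⟨?_, ?_, ?_⟩
  · nlinarith
  · nlinarith
  · nlinarith

/-- **Data at `R` on the window** (`L ≥ L₀`, `0 ≤ E ≤ E₁`): `m_E'(R) ≥ ¾`, `m_E(R) ≥ ¾R`,
`|m_E'(R) - u'(R)| ≤ C₂E`, `|m_E(R) - u(R)| ≤ C₁ER`. [folklore] -/
theorem window_data {L E : ℝ} (hV : Measurable V) (hV3 : ∫⁻ s in Ioi (0 : ℝ), ENNReal.ofReal (s ^ 2) * V s ^ 3 ≠ ⊤)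
    (hR : 0 < R) (hL : neumannThreshold V R ≤ L) (hE : 0 ≤ E) (hE1 : E ≤ neumannWindow R L) :
    3 / 4 ≤ volterraDeriv (neumannCoeff V E) R ∧ 3 / 4 * R ≤ volterraSol (neumannCoeff V E) R ∧
    |volterraDeriv (neumannCoeff V E) R - volterraDeriv (neumannCoeff V 0) R| ≤ pertC₂ V R * E ∧
    |volterraSol (neumannCoeff V E) R - volterraSol (neumannCoeff V 0) R| ≤ pertC₁ V R * E * R := by
  obtain ⟨h1, h2, h3⟩ := window_pert_small hL hE hE1
  obtain ⟨hα₀, hβ₀, -⟩ := zeroEnergy_data_bounds hV hV3 hR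
  have hRm : R ∈ Icc 0 R := ⟨hR.le, le_rfl⟩
  have ha := abs_deriv_sub_zeroEnergy_le hV hV3 hR.le hE h3 hRm
  have hb := abs_sub_zeroEnergy_le hV hV3 hR.le hE h3 hRm
  refine ⟨?_, ?_, ha, hb⟩
  · rw [abs_le] at ha; linarith [ha.1]
  · rw [abs_le] at hb; nlinarith [hb.1, hR]

/-- **The sign at the top of the window**: `g(E₁) < 0` for `L ≥ L₀` (at `x = √E₁(L-R) = ½`:
`L cos x - D sinc x ≤ (D + R)·1349/1536 - D·4597/4800 < 0` as `R ≤ D/16`, while `β ≥ 0` and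
`cos x + E₁LD sinc x > 0`). [cite: ErdosSchleinYau2006, App. A (proof of Lemma A.1 (i): `kL = tan(k(L-a))`)] -/
theorem neumannBdry_window_neg (hV : Measurable V) (hV3 : ∫⁻ s in Ioi (0 : ℝ), ENNReal.ofReal (s ^ 2) * V s ^ 3 ≠ ⊤)
    (hR : 0 < R) (hVR : ∀ r, R < r → V r = 0) {L : ℝ} (hL : neumannThreshold V R ≤ L) :
    neumannBdry V L (neumannWindow R L) < 0 := by
  set E₁ := neumannWindow R L with hE₁
  set D := L - R with hDdef
  have hD1 : 1 ≤ D := one_le_sub_of_threshold hL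
  have hD : 0 < D := by linarith
  obtain ⟨h16, -⟩ := threshold_le_iff_aux hL
  have hE₁0 : 0 ≤ E₁ := (neumannWindow_pos hL).le
  have hx : Real.sqrt E₁ * (L - R) = 1 / 2 := sqrt_neumannWindow_mul hL
  obtain ⟨hα, hβ, -, -⟩ := window_data hV hV3 hR hL hE₁0 le_rfl
  rw [neumannBdry_eq hV hV3 hR.le hVR hE₁0 (by linarith), hx]
  -- bounds on `cos ½`, `sinc ½`
  have hhalf : |(1 / 2 : ℝ)| ≤ 1 := by rw [abs_of_nonneg (by norm_num)]; norm_num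
  have hc := abs_cos_sub_le hhalf
  have hs := abs_sinc_sub_le hhalf
  rw [abs_le] at hc hs
  have hcos_le : Real.cos (1 / 2) ≤ 1349 / 1536 := by nlinarith [hc.2]
  have hcos_ge : 0 < Real.cos (1 / 2) := by nlinarith [hc.1]
  have hsinc_ge : 4597 / 4800 ≤ Real.sinc (1 / 2) := by nlinarith [hs.1]
  -- `A₁ < 0`, `A₂ > 0`
  have hA₁ : L * Real.cos (1 / 2) - (L - R) * Real.sinc (1 / 2) < 0 := by
    have hL' : L = D + R := by rw [hDdef]; ring
    rw [hL']
    have hR16 : R ≤ D / 16 := by linarith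
    nlinarith [mul_le_mul_of_nonneg_left hcos_le (by linarith : 0 ≤ D + R),
      mul_le_mul_of_nonneg_left hsinc_ge hD.le]
  have hA₂ : 0 < Real.cos (1 / 2) + E₁ * L * (L - R) * Real.sinc (1 / 2) := by
    have : 0 ≤ E₁ * L * (L - R) * Real.sinc (1 / 2) := by
      have hL0 : 0 ≤ L := by linarith
      have : 0 ≤ Real.sinc (1 / 2) := by linarith
      positivity
    linarith
  have h1 : volterraDeriv (neumannCoeff V E₁) R * (L * Real.cos (1 / 2) - (L - R) * Real.sinc (1 / 2)) < 0 :=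
    mul_neg_of_pos_of_neg (by linarith) hA₁
  have h2 : 0 ≤ volterraSol (neumannCoeff V E₁) R * (Real.cos (1 / 2) + E₁ * L * (L - R) * Real.sinc (1 / 2)) :=
    mul_nonneg (by nlinarith [hR]) hA₂.le
  linarith

/-- **Existence of a Neumann eigenvalue in the window** (intermediate value theorem for `g` on
`[0, E₁]`: `g(0) = u'(R)a ≥ 0 > g(E₁)`). [cite: ErdosSchleinYau2006, Lemma A.1 (i); BastiCenatiempoSchlein2021, Lemma 2.1] -/
theorem exists_neumannZero (hV : Measurable V) (hV3 : ∫⁻ s in Ioi (0 : ℝ), ENNReal.ofReal (s ^ 2) * V s ^ 3 ≠ ⊤)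
    (hR : 0 < R) (hVR : ∀ r, R < r → V r = 0) {L : ℝ} (hL : neumannThreshold V R ≤ L) :
    ∃ E ∈ Icc 0 (neumannWindow R L), neumannBdry V L E = 0 := by
  have hD1 := one_le_sub_of_threshold hL
  have hE₁0 : 0 ≤ neumannWindow R L := (neumannWindow_pos hL).le
  have hcont : ContinuousOn (neumannBdry V L) (Icc 0 (neumannWindow R L)) :=
    (continuousOn_neumannBdry hV hV3 (by linarith)).mono fun E hE => hE.1
  have h0 : 0 ≤ neumannBdry V L 0 := neumannBdry_zero_nonneg hV hV3 hR hVR (by linarith)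
  have h1 : neumannBdry V L (neumannWindow R L) < 0 := neumannBdry_window_neg hV hV3 hR hVR hL
  have hmem : (0 : ℝ) ∈ Icc (neumannBdry V L (neumannWindow R L)) (neumannBdry V L 0) := ⟨h1.le, h0⟩
  obtain ⟨E, hE, hgE⟩ := intermediate_value_Icc' hE₁0 hcont hmem
  exact ⟨E, hE, hgE⟩

/-- **The lowest Neumann eigenvalue**: for `L ≥ L₀`, `λ = neumannEigenvalue V L` satisfies
`0 ≤ λ ≤ 1/(4(L-R)²)` and `g(λ) = 0`, and no `E ∈ [0, λ)` has `g(E) = 0`.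
[cite: BastiCenatiempoSchlein2021, Lemma 2.1; ErdosSchleinYau2006, Lemma A.1] -/
theorem neumannEigenvalue_spec (hV : Measurable V) (hV3 : ∫⁻ s in Ioi (0 : ℝ), ENNReal.ofReal (s ^ 2) * V s ^ 3 ≠ ⊤)
    (hR : 0 < R) (hVR : ∀ r, R < r → V r = 0) {L : ℝ} (hL : neumannThreshold V R ≤ L) :
    0 ≤ neumannEigenvalue V L ∧ neumannEigenvalue V L ≤ neumannWindow R L ∧
      neumannBdry V L (neumannEigenvalue V L) = 0 ∧
      ∀ E, 0 ≤ E → E < neumannEigenvalue V L → neumannBdry V L E ≠ 0 := by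
  have hD1 := one_le_sub_of_threshold hL
  set S := {E : ℝ | 0 ≤ E ∧ neumannBdry V L E = 0} with hS
  obtain ⟨E, hE, hgE⟩ := exists_neumannZero hV hV3 hR hVR hL
  have hES : E ∈ S := ⟨hE.1, hgE⟩
  have hne : S.Nonempty := ⟨E, hES⟩
  have hbdd : BddBelow S := ⟨0, fun E' hE' => hE'.1⟩
  have hclosed : IsClosed S := isClosed_neumannZeroSet hV hV3 (by linarith)
  have hmem : neumannEigenvalue V L ∈ S := hclosed.csInf_mem hne hbdd
  refine ⟨hmem.1, (csInf_le hbdd hES).trans hE.2, hmem.2, fun E' hE'0 hE'lt hg => ?_⟩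
  have : neumannEigenvalue V L ≤ E' := csInf_le hbdd ⟨hE'0, hg⟩
  linarith

/-- If the scattering length vanishes then `λ = 0`; if `λ = 0` then `a = 0`. [folklore] -/
theorem neumannEigenvalue_eq_zero_iff (hV : Measurable V) (hV3 : ∫⁻ s in Ioi (0 : ℝ), ENNReal.ofReal (s ^ 2) * V s ^ 3 ≠ ⊤)
    (hR : 0 < R) (hVR : ∀ r, R < r → V r = 0) {L : ℝ} (hL : neumannThreshold V R ≤ L) :
    neumannEigenvalue V L = 0 ↔ volterraScatteringLength V R = 0 := by
  obtain ⟨h0, -, hg, hmin⟩ := neumannEigenvalue_spec hV hV3 hR hVR hL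
  have hD1 := one_le_sub_of_threshold hL
  have hα₀ := (zeroEnergy_data_bounds hV hV3 hR).1
  have hg0 := neumannBdry_zero_eq hV hV3 hR hVR (L := L) (by linarith)
  constructor
  · intro h
    rw [h, hg0] at hg
    rcases mul_eq_zero.1 hg with h1 | h1
    · linarith
    · exact h1
  · intro h
    rw [h, mul_zero] at hg0
    by_contra hne
    exact hmin 0 le_rfl (lt_of_le_of_ne h0 (Ne.symm hne)) hg0

end Existence

/-! ### The asymptotics `λ = 3a/L³ + O(L⁻⁴)` of the lowest Neumann eigenvalue -/

section Asymptotics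

/-- **The root equation to second order** (pure algebra): if
`(L cos x - D sinc x) - b (cos x + E L D sinc x) = 0` with `x = √E D`, `0 ≤ E`, `0 ≤ D ≤ L`,
`E D² ≤ 1`, then `|E·P - (L - D - b)| ≤ E² L D³ (D/16 + |b|/4)` for
`P = D²(3L - D)/6 + b D (L - D/2)`. [cite: ErdosSchleinYau2006, App. A (proof of Lemma A.1 (i))] -/
theorem root_estimate {E D L b : ℝ} (hE : 0 ≤ E) (hD : 0 ≤ D) (hDL : D ≤ L) (hED : E * D ^ 2 ≤ 1)
    (hroot : (L * Real.cos (Real.sqrt E * D) - D * Real.sinc (Real.sqrt E * D)) -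
      b * (Real.cos (Real.sqrt E * D) + E * L * D * Real.sinc (Real.sqrt E * D)) = 0) :
    |E * (D ^ 2 * (3 * L - D) / 6 + b * D * (L - D / 2)) - (L - D - b)| ≤
      E ^ 2 * L * D ^ 3 * (D / 16 + |b| / 4) := by
  obtain ⟨h1, h2⟩ := abs_tail_combinations_le hE hD hDL hED
  set ρ₁ := (L * Real.cos (Real.sqrt E * D) - D * Real.sinc (Real.sqrt E * D)) - (L - D - E * D ^ 2 * (3 * L - D) / 6)
  set ρ₂ := (Real.cos (Real.sqrt E * D) + E * L * D * Real.sinc (Real.sqrt E * D)) - (1 + E * D * (L - D / 2))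
  have hkey : E * (D ^ 2 * (3 * L - D) / 6 + b * D * (L - D / 2)) - (L - D - b) = ρ₁ - b * ρ₂ := by
    simp only [ρ₁, ρ₂]; linarith [hroot]
  rw [hkey]
  calc |ρ₁ - b * ρ₂| ≤ |ρ₁| + |b * ρ₂| := abs_sub _ _
    _ = |ρ₁| + |b| * |ρ₂| := by rw [abs_mul]
    _ ≤ E ^ 2 * D ^ 4 * L / 16 + |b| * (E ^ 2 * L * D ^ 3 / 4) := by
        gcongr
    _ = E ^ 2 * L * D ^ 3 * (D / 16 + |b| / 4) := by ring

variable {V : ℝ → ℝ≥0∞} {R : ℝ}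

set_option maxHeartbeats 400000 in
/-- **Lemma 2.1 (i): `λ_ℓ = 3𝔞/L³ (1 + O(𝔞/L))`**, in the explicit form
`|λ - 3a/L³| ≤ 55 R²/L⁴` for `L ≥ L₀` (`L = N^{1-κ}ℓ` the radius of the Neumann ball, `a` the
scattering length, `R` the range of `V`; also `0 ≤ a_λ` and `λ (L-R)² L ≤ 4R`).
[cite: BastiCenatiempoSchlein2021, Lemma 2.1 (i); BoccatoEtAl2019, Lemma 4.1 (i) (4.5); ErdosSchleinYau2006, Lemma A.1 (i) (A.1)] -/
theorem abs_neumannEigenvalue_sub_le (hV : Measurable V) (hV3 : ∫⁻ s in Ioi (0 : ℝ), ENNReal.ofReal (s ^ 2) * V s ^ 3 ≠ ⊤)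
    (hR : 0 < R) (hVR : ∀ r, R < r → V r = 0) {L : ℝ} (hL : neumannThreshold V R ≤ L) :
    |neumannEigenvalue V L - 3 * volterraScatteringLength V R / L ^ 3| ≤ 55 * R ^ 2 / L ^ 4 ∧
      neumannEigenvalue V L * ((L - R) ^ 2 * L) ≤ 4 * R := by
  obtain ⟨hl0, hl1, hg, -⟩ := neumannEigenvalue_spec hV hV3 hR hVR hL
  have hD1 : 1 ≤ L - R := one_le_sub_of_threshold hL
  obtain ⟨h16, hC12⟩ := threshold_le_iff_aux hL
  have hC₁ := pertC₁_nonneg (V := V) (R := R)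
  have hC₂ := pertC₂_nonneg (V := V) (R := R)
  -- data at `R`, window facts, the root equation
  obtain ⟨hα, hβ, hαd, hβd⟩ := window_data hV hV3 hR hL hl0 hl1
  obtain ⟨hα₀, hβ₀, hβ₀'⟩ := zeroEnergy_data_bounds hV hV3 hR
  obtain ⟨hED4, hx⟩ := window_mul_sq_le hL hl0 hl1
  have hroot0 := hg
  rw [neumannBdry_eq hV hV3 hR.le hVR hl0 (by linarith only [hD1] : R ≤ L)] at hroot0
  have ha' : volterraScatteringLength V R =
      R - volterraSol (neumannCoeff V 0) R / volterraDeriv (neumannCoeff V 0) R := rfl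
  rw [ha']
  -- make the data opaque
  set lam := neumannEigenvalue V L with hlam
  set α := volterraDeriv (neumannCoeff V lam) R with hαdef
  set β := volterraSol (neumannCoeff V lam) R with hβdef
  set α₀ := volterraDeriv (neumannCoeff V 0) R with hα₀def
  set β₀ := volterraSol (neumannCoeff V 0) R with hβ₀def
  set C₁ := pertC₁ V R with hC₁def
  set C₂ := pertC₂ V R with hC₂def
  set D := L - R with hDdef
  clear_value lam α β α₀ β₀ C₁ C₂ D
  have hD : 0 < D := by linarith only [hD1]
  have hLD : L = D + R := by rw [hDdef]; ring
  have hL0 : 0 < L := by linarith only [hD1, hLD, hR]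
  have hDL : D ≤ L := by linarith only [hLD, hR]
  have hαpos : 0 < α := by linarith only [hα]
  have hα₀pos : 0 < α₀ := by linarith only [hα₀]
  have hβpos : 0 ≤ β := by nlinarith only [hβ, hR]
  set b := β / α with hbdef
  clear_value b
  have hb0 : 0 ≤ b := by rw [hbdef]; exact div_nonneg hβpos hαpos.le
  set aE := R - b with haE
  set a := R - β₀ / α₀ with hadef
  clear_value aE a
  have hED : lam * D ^ 2 ≤ 1 := by linarith only [hED4]
  -- the root equation divided by `α`
  have hroot : (L * Real.cos (Real.sqrt lam * D) - D * Real.sinc (Real.sqrt lam * D)) -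
      b * (Real.cos (Real.sqrt lam * D) + lam * L * D * Real.sinc (Real.sqrt lam * D)) = 0 := by
    have h := congrArg (fun t => t / α) hroot0
    simp only [zero_div] at h
    rw [← h, hbdef]
    field_simp
  -- Step A
  have hA := root_estimate hl0 hD.le hDL hED hroot
  rw [abs_of_nonneg hb0] at hA
  set P := D ^ 2 * (3 * L - D) / 6 + b * D * (L - D / 2) with hPdef
  clear_value P
  have hLDb : L - D - b = aE := by rw [haE, hLD]; ring
  rw [hLDb] at hA
  -- Step B: a priori bound `λ D² L /4 ≤ aE ≤ R`
  have hbDL : 0 ≤ b * D * L := by positivity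
  have hPge : D ^ 2 * L / 3 + b * D * L / 2 ≤ P := by
    have h1 : P - (D ^ 2 * L / 3 + b * D * L / 2) = D ^ 2 * (L - D) / 6 + b * D * (L - D) / 2 := by rw [hPdef]; ring
    have h2 : 0 ≤ D ^ 2 * (L - D) / 6 + b * D * (L - D) / 2 := by
      have : 0 ≤ L - D := by linarith only [hDL]
      positivity
    linarith only [h1, h2]
  have hrem : lam ^ 2 * L * D ^ 3 * (D / 16 + b / 4) ≤ lam * (L * D ^ 2 / 64 + L * D * b / 16) := by
    -- `λ² L D³ (D/16 + b/4) = λ (λD²) L D (D/16 + b/4) ≤ λ (1/4) L D (D/16 + b/4)`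
    have h1 : lam ^ 2 * L * D ^ 3 * (D / 16 + b / 4) = lam * (lam * D ^ 2) * (L * D * (D / 16 + b / 4)) := by ring
    rw [h1]
    have h2 : 0 ≤ L * D * (D / 16 + b / 4) := by positivity
    calc lam * (lam * D ^ 2) * (L * D * (D / 16 + b / 4)) ≤ lam * (1 / 4) * (L * D * (D / 16 + b / 4)) :=
          mul_le_mul_of_nonneg_right (mul_le_mul_of_nonneg_left (by linarith only [hED4]) hl0) h2
      _ = lam * (L * D ^ 2 / 64 + L * D * b / 16) := by ring
  have hlamDL : 0 ≤ lam * (D ^ 2 * L) := by positivity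
  have hlambDL : 0 ≤ lam * (b * D * L) := by positivity
  have haEge : lam * (D ^ 2 * L) / 4 ≤ aE := by
    have h1 := (abs_le.1 hA).2   -- `λP - aE ≤ rem`
    have h3 : lam * (D ^ 2 * L / 3 + b * D * L / 2) ≤ lam * P := mul_le_mul_of_nonneg_left hPge hl0
    linarith only [h1, h3, hrem, hlamDL, hlambDL]
  have haE0 : 0 ≤ aE := le_trans (by positivity) haEge
  have hbR : b ≤ R := by linarith only [haE0, haE, hb0]
  have haER : aE ≤ R := by linarith only [haE, hb0]
  have hlamB : lam * (D ^ 2 * L) ≤ 4 * R := by linarith only [haEge, haER]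
  -- Step D1: `|λP - aE| ≤ (5/4) R²/L`, in the form `|λP - aE| L ≤ (5/4) R²`
  have hD1' : |lam * P - aE| * L ≤ 5 / 4 * R ^ 2 := by
    -- multiply by `D > 0`: `rem · L · D = (λ D² L)² (D/16 + b/4) ≤ 16R² (D/16 + R/4) ≤ (5/4) R² D`
    have h1 : |lam * P - aE| * L * D ≤ lam ^ 2 * L * D ^ 3 * (D / 16 + b / 4) * L * D :=
      mul_le_mul_of_nonneg_right (mul_le_mul_of_nonneg_right hA hL0.le) hD.le
    have h2 : lam ^ 2 * L * D ^ 3 * (D / 16 + b / 4) * L * D = (lam * (D ^ 2 * L)) ^ 2 * (D / 16 + b / 4) := by ring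
    have h3 : (lam * (D ^ 2 * L)) ^ 2 ≤ (4 * R) ^ 2 := pow_le_pow_left₀ hlamDL hlamB 2
    have h46 : D / 16 + b / 4 ≤ D / 16 + R / 4 := by linarith only [hbR]
    have h47 : 0 ≤ D / 16 + b / 4 := by linarith only [hD, hb0]
    have h48 : 0 ≤ (4 * R) ^ 2 := sq_nonneg _
    have h4 : (lam * (D ^ 2 * L)) ^ 2 * (D / 16 + b / 4) ≤ (4 * R) ^ 2 * (D / 16 + R / 4) :=
      mul_le_mul h3 h46 h47 h48
    have h49 : R ^ 2 * (16 * R) ≤ R ^ 2 * D := mul_le_mul_of_nonneg_left h16 (sq_nonneg R)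
    have h5 : (4 * R) ^ 2 * (D / 16 + R / 4) ≤ 5 / 4 * R ^ 2 * D := by linarith only [h49]
    have h6 : |lam * P - aE| * L * D ≤ 5 / 4 * R ^ 2 * D := by linarith only [h1, h2, h4, h5]
    exact le_of_mul_le_mul_right h6 hD
  -- Step D2: `P ≥ L³/12` and `|λ - aE/P| ≤ 15 R²/L⁴`
  have hDhalf : L / 2 ≤ D := by linarith only [h16, hLD, hR]
  have hPL : L ^ 3 / 12 ≤ P := by
    have h1 : (L / 2) ^ 2 ≤ D ^ 2 := pow_le_pow_left₀ (by positivity) hDhalf 2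
    have h2 : (L / 2) ^ 2 * L ≤ D ^ 2 * L := mul_le_mul_of_nonneg_right h1 hL0.le
    linarith only [hPge, h2, hbDL]
  have hPpos : 0 < P := lt_of_lt_of_le (by positivity) hPL
  have hD2 : |lam - aE / P| ≤ 15 * R ^ 2 / L ^ 4 := by
    have h1 : lam - aE / P = (lam * P - aE) / P := by field_simp
    rw [h1, abs_div, abs_of_pos hPpos, div_le_iff₀ hPpos]
    have h2 : |lam * P - aE| ≤ 5 / 4 * R ^ 2 / L := by rw [le_div_iff₀ hL0]; exact hD1'
    calc |lam * P - aE| ≤ 5 / 4 * R ^ 2 / L := h2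
      _ = 15 * R ^ 2 / L ^ 4 * (L ^ 3 / 12) := by field_simp; ring
      _ ≤ 15 * R ^ 2 / L ^ 4 * P := by gcongr
  -- Step D3: `|aE/P - 3aE/L³| ≤ 24 R²/L⁴`
  have hD3 : |aE / P - 3 * aE / L ^ 3| ≤ 24 * R ^ 2 / L ^ 4 := by
    have h1 : aE / P - 3 * aE / L ^ 3 = aE * (L ^ 3 - 3 * P) / (P * L ^ 3) := by field_simp
    have h3P : L ^ 3 - 3 * P = 3 * aE * L ^ 2 / 2 - (R ^ 3 - 3 * b * R ^ 2) / 2 := by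
      rw [hPdef, haE, hLD]; ring
    have hRL : 4 * R ≤ L := by linarith only [h16, hLD, hR]
    have hR2 : 0 ≤ R ^ 2 := sq_nonneg R
    have hL2 : 0 ≤ L ^ 2 := sq_nonneg L
    have h2 : |L ^ 3 - 3 * P| ≤ 2 * R * L ^ 2 := by
      rw [h3P, abs_le]
      have e1 : 0 ≤ aE * L ^ 2 := mul_nonneg haE0 hL2
      have e2 : aE * L ^ 2 ≤ R * L ^ 2 := mul_le_mul_of_nonneg_right haER hL2
      have e3 : 0 ≤ b * R ^ 2 := mul_nonneg hb0 hR2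
      have e4 : b * R ^ 2 ≤ R * R ^ 2 := mul_le_mul_of_nonneg_right hbR hR2
      have e5 : R ^ 3 = R * R ^ 2 := by ring
      have e6 : R * R ^ 2 ≤ R * L ^ 2 / 16 := by
        have : R ^ 2 ≤ L ^ 2 / 16 := by nlinarith only [hRL, hR]
        exact (mul_le_mul_of_nonneg_left this hR.le).trans (by ring_nf; rfl)
      constructor
      · linarith only [e1, e3, e5, e6, mul_nonneg hR.le hR2]
      · linarith only [e2, e3, e4, e5, e6]
    rw [h1, abs_div, abs_mul, abs_of_nonneg haE0, abs_of_pos (by positivity : 0 < P * L ^ 3),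
      div_le_iff₀ (by positivity)]
    calc aE * |L ^ 3 - 3 * P| ≤ R * (2 * R * L ^ 2) := by gcongr
      _ = 24 * R ^ 2 / L ^ 4 * (L ^ 3 / 12 * L ^ 3) := by field_simp; ring
      _ ≤ 24 * R ^ 2 / L ^ 4 * (P * L ^ 3) := by gcongr
  -- Step D4: `|aE - a| ≤ (16/3) R²/L`, hence `|3aE/L³ - 3a/L³| ≤ 16 R²/L⁴`
  have hD4 : |3 * aE / L ^ 3 - 3 * a / L ^ 3| ≤ 16 * R ^ 2 / L ^ 4 := by
    have h1 : aE - a = (β₀ * α - β * α₀) / (α * α₀) := by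
      rw [haE, hadef, hbdef]; field_simp; ring
    have h2 : |β₀ * α - β * α₀| ≤ α₀ * R * lam * (C₁ + C₂) := by
      have h3 : β₀ * α - β * α₀ = β₀ * (α - α₀) - α₀ * (β - β₀) := by ring
      rw [h3]
      calc |β₀ * (α - α₀) - α₀ * (β - β₀)| ≤ |β₀ * (α - α₀)| + |α₀ * (β - β₀)| := abs_sub _ _
        _ = β₀ * |α - α₀| + α₀ * |β - β₀| := by
            rw [abs_mul, abs_mul, abs_of_nonneg (by linarith only [hβ₀, hR] : 0 ≤ β₀), abs_of_nonneg hα₀pos.le]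
        _ ≤ (R * α₀) * (C₂ * lam) + α₀ * (C₁ * lam * R) := by
            gcongr
        _ = α₀ * R * lam * (C₁ + C₂) := by ring
    have h4 : |aE - a| ≤ 4 / 3 * R * lam * (C₁ + C₂) := by
      rw [h1, abs_div, abs_of_pos (mul_pos hαpos hα₀pos), div_le_iff₀ (mul_pos hαpos hα₀pos)]
      refine h2.trans ?_
      have h5 : 0 ≤ α₀ * R * lam * (C₁ + C₂) := by positivity
      have h6 : α₀ * R * lam * (C₁ + C₂) * 1 ≤ α₀ * R * lam * (C₁ + C₂) * (4 / 3 * α) :=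
        mul_le_mul_of_nonneg_left (by linarith only [hα]) h5
      linarith only [h6]
    have h5 : |aE - a| * L ≤ 16 / 3 * R ^ 2 := by
      have h6 : lam * (C₁ + C₂) * L ≤ 4 * R := by
        have h7 : C₁ + C₂ ≤ D := by linarith only [hC12]
        calc lam * (C₁ + C₂) * L ≤ lam * D * L := by gcongr
          _ ≤ lam * D * L * D := le_mul_of_one_le_right (by positivity) hD1
          _ = lam * (D ^ 2 * L) := by ring
          _ ≤ 4 * R := hlamB
      calc |aE - a| * L ≤ 4 / 3 * R * lam * (C₁ + C₂) * L := mul_le_mul_of_nonneg_right h4 hL0.le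
        _ = 4 / 3 * R * (lam * (C₁ + C₂) * L) := by ring
        _ ≤ 4 / 3 * R * (4 * R) := by gcongr
        _ = 16 / 3 * R ^ 2 := by ring
    have h7 : 3 * aE / L ^ 3 - 3 * a / L ^ 3 = 3 * (aE - a) / L ^ 3 := by ring
    rw [h7, abs_div, abs_mul, abs_of_pos (by norm_num : (0 : ℝ) < 3), abs_of_pos (by positivity : 0 < L ^ 3),
      div_le_iff₀ (by positivity)]
    calc 3 * |aE - a| = 3 * (|aE - a| * L) / L := by field_simp
      _ ≤ 3 * (16 / 3 * R ^ 2) / L := by gcongr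
      _ = 16 * R ^ 2 / L ^ 4 * L ^ 3 := by field_simp
  -- assemble
  refine ⟨?_, hlamB⟩
  have htri : |lam - 3 * a / L ^ 3| ≤ |lam - aE / P| + |aE / P - 3 * aE / L ^ 3| + |3 * aE / L ^ 3 - 3 * a / L ^ 3| := by
    have e : lam - 3 * a / L ^ 3 = (lam - aE / P) + (aE / P - 3 * aE / L ^ 3) + (3 * aE / L ^ 3 - 3 * a / L ^ 3) := by ring
    rw [e]
    exact (abs_add_le _ _).trans (add_le_add (abs_add_le _ _) le_rfl)
  calc |lam - 3 * a / L ^ 3| ≤ 15 * R ^ 2 / L ^ 4 + 24 * R ^ 2 / L ^ 4 + 16 * R ^ 2 / L ^ 4 := by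
        linarith only [htri, hD2, hD3, hD4]
    _ = 55 * R ^ 2 / L ^ 4 := by ring

end Asymptotics





end Literature.MathematicalPhysics.QuantumManyBody.BoseGas
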